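import Literature.Geometry.Lorentzian.KerrHorizonRegularWaveBoundedness
import Literature.Geometry.Lorentzian.KerrDomainOfDependence
import Literature.Geometry.Lorentzian.KerrSurgeryBackgroundBounds
import Literature.Geometry.Lorentzian.KerrSchildGraphDivergence
import HarnessLib

/-!
# Finite-in-time energy estimates up to the future event horizon for the Kerr wave equation
# (towards `DafermosRodnianskiShlapentokhRothman2016_energyBoundedness_horizonRegular`)

(family `gr`; namespace `Literature.Geometry.Lorentzian`, auxiliary material in
`Literature.Geometry.Lorentzian.Kerr`)

`KerrHorizonRegularWaveBoundedness.lean` vendors estimate (23) of Theorem 3.1 of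
Dafermos–Rodnianski–Shlapentokh-Rothman (arXiv:1402.7034 = Ann. of Math. 183 (2016)) in its §3.3
form (admissible hypersurfaces `Σ̃_τ = φ_τ(Σ̃₀)`) for the printed, horizon-regular class of
solutions, as the named fact
`DafermosRodnianskiShlapentokhRothman2016_energyBoundedness_horizonRegular`: **uniform** (in `τ ≥ 0`)
boundedness of the non-degenerate energy. Its printed proof is the whole of §§4–13 of that paper
(Carter separation, the frequency-localised multiplier estimates of §8, quantitative mode
stability, the continuity argument in `a` of §11, boundedness a posteriori from the phase-space
integrated local energy decay, §13) on top of Dafermos–Rodnianski arXiv:1010.5132 (red-shift,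
Prop. 4.6.1); none of this is reproduced in this library.

This file proves the **elementary, finite-in-time** counterpart which the printed argument uses as
an ingredient in two places — the reduction to general admissible hypersurfaces ("a reduction proven
as Proposition 4.6.1 of [dr7]", arXiv:1402.7034, §3.3, p. 14) and the extension of the solution to
the past ("an easy domain of dependence argument and finite in time energy estimates", ibid.
§13.1.1, p. 63) — for the leaves `{t* = τ}` of the ingoing Kerr–Schild chart, **up to and with
constants uniform towards the future event horizon `𝓗⁺ = {r = r₊}`**:

* `Kerr.exterior_coordEnergy_le_exp` — for subextremal `(M, a)` there are
  `C₀ = 18 (1 + 4M/r₊)²` and `C₁ = 192 (1 + 4M/r₊) D(M, a)` such that for every function `Φ` on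
  `ℝ⁴` of class `C²` at the points of the exterior `{r > r₊}` and solving the Kerr wave equation
  `∑_μ ∂_μ(g^{μν} ∂_νΦ) = 0` there, and every `τ ≥ 0`,
  `∫_{{t* = τ} ∩ {r > r₊}} ∑_μ (∂_μΦ)² dy ≤ C₀ e^{C₁ τ} ∫_{{t* = 0} ∩ {r > r₊}} ∑_μ (∂_μΦ)² dy`
  (as `[0, ∞]`-valued integrals; no support or integrability hypothesis);
* `Literature.Geometry.Lorentzian.kerr_exterior_sliceEnergy_le_exp`,
  `Literature.Geometry.Lorentzian.kerr_exterior_sliceEnergy_finiteTime` — the same for smooth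
  solutions `ψ : Kerr.exterior M a → ℝ` of `□_g ψ = 0` (the prelude's d'Alembertian of
  `Kerr.smoothMetric`, as in gr.S24) and the coordinate energy `sliceEnergy` of
  `WeightedNorms.lean`, in the `C₀ e^{C₁ τ}` form and in the form
  `∀ T, ∃ C < ∞, ∀ ψ, ∀ τ ∈ [0, T], E(τ) ≤ C · E(0)`;
* `Literature.Geometry.Lorentzian.kerr_horizonRegular_sliceEnergy_finiteTime` — the same for the
  horizon-regular class of the named fact (`ψ` smooth on a horizon-penetrating chart
  `Kerr.region a r₀`, `r₀ ≤ r₊`, solving the wave equation on `{r > r₊}` only), i.e. the conclusion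
  of `kerr_leafEnergy_boundedness_of` (the consumer of the named fact in
  `Summits/FinalStateConjecture/…/ZeroEnergyKerrOrBombKerrModeStabilityLeaf.lean`) with a
  constant allowed to depend on an upper bound `T` for `τ`.

Part II of the file carries the same argument over to the **translates `Σ̃_τ = {t* = τ + F(y)}`
of a uniformly spacelike graph** — the foliation `φ_τ(Σ̃₀)` of the named fact (admissible heights,
`Kerr.IsAdmissibleHeight`):

* `KerrSchild.Background.mul_normalCurrent_zero_le_graphFlux`, `abs_graphFlux_le`,
  `abs_normalCurrent_le` — the flux `∑_μ n_μ P^μ` of the `dt*`-current through a graph of slope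
  `|∇F| ≤ 1 − c` is two-sided comparable with `∑(∂Φ)²` (`≥ c P⁰` by the dominant energy condition);
* `Kerr.graphWeight`, `Kerr.graphWeight_flux` — the weight `χ(A − t*) χ(cone) χ(horizon)` with an
  upper time cutoff only, decreasing along the energy flow at *every* point;
* `KerrSchild.Background.graphWeightedEnergy_le` — Grönwall for the weighted energy through the
  graph leaves, from the divergence identity between two graphs of
  `KerrSchildGraphDivergence.lean` (arXiv:1402.7034, §2.3.2) and the substitution `u = θ s`;
* `Kerr.exterior_graphCoordEnergy_le_exp`, `kerr_exterior_graphSliceEnergy_le_exp` — for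
  `‖dF‖ ≤ 1 − c`: `E_F(τ) ≤ (144 (1 + 4M/r₊)²/c) e^{(192 (1 + 4M/r₊) D/c) τ} E_F(0)`,
  `E_F(τ) = graphSliceEnergy (Kerr.exterior M a) ψ F τ` the coordinate energy through
  `Σ̃_τ ∩ {r > r₊}`;
* `Literature.Geometry.Lorentzian.kerr_horizonRegular_graphSliceEnergy_finiteTime` — **the
  inequality of the named fact itself** (same foliation, same energies, same horizon-regular class,
  indeed without the compact-support hypothesis), `∀ T, ∃ C < ∞, ∀ ψ, ∀ τ ∈ [0, T],
  E_F(τ) ≤ C · E_F(0)`, **with `C` allowed to depend on `T`**.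

What separates these statements from the named fact is exactly the deep content of the Annals
paper: a constant independent of `T`.

## Proof

Hawking–Ellis's energy argument (*The large scale structure of space-time*, 1973, §4.3,
Lemma 4.3.1) in the weighted form `KerrSchild.Background.weightedEnergy_le` of
`KerrSchildLocalEnergy.lean` (Grönwall for `E_W(t) = ∫ W P⁰ dy`, `P^μ = T^{μ0}` the `dt*`-current,
for weights `W ≥ 0` decreasing along the energy flow), run on the surgered background
`Kerr.surgeryBackground M a r₊` (whose inverse metric is Kerr's near every exterior point) with the
weight `Kerr.dodWeight M a τ A ε 0` of `KerrDomainOfDependence.lean`: a smoothed indicator of the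
solid backward coordinate cone `{‖y‖ < A − t*}` times a smoothed indicator of
`{r − r₊ > ε e^{t*/(2M)}}`, a region receding from the horizon exponentially slowly whose outward
conormal is past causal (`Kerr.dodWeight_flux`, from `Kerr.horizonCovector_causal` — the covector
form of "past-directed causal curves in `{r > r₊}` do not reach `𝓗⁺` at finite `t*`",
arXiv:1402.7034, §2.2.5 — and the dominant energy condition). The Grönwall rate is uniform in
`A` and `ε` because one bound `D(M, a)` for `|∂g^{αβ}|` serves on all of `ℝ⁴`
(`Kerr.exists_bound_fderiv_surgeryBackground_inverseMetric`), and the density `P⁰` is two-sided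
comparable with `∑_μ (∂_μΦ)²` (`sum_sq_le_six_mul_normalCurrent_zero`, `normalCurrent_zero_le`).
At time `τ` the weight is `1` on `{‖y‖ ≤ A − τ − 1} ∩ {r − r₊ ≥ 2ε e^{τ/(2M)}}`, at time `0` it is
at most the indicator of the exterior slice; letting `ε → 0`, `A → ∞` along a sequence, the sets
exhaust the exterior slice `{r > r₊}` increasingly and the monotone convergence theorem
(`lintegral_iSup`) concludes. No compact-support hypothesis and no divergence theorem on domains
with corners are needed.

## References

* M. Dafermos, I. Rodnianski, Y. Shlapentokh-Rothman, *Decay for solutions of the wave equation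
  on Kerr exterior spacetimes III: the full subextremal case `|a| < M`*, Ann. of Math. 183 (2016)
  787–913, arXiv:1402.7034: Thm. 3.1 (23), §3.3 (p. 14), §4.1, §13.1.1 (p. 63), §2.2.5,
  §2.3.2 (the divergence identity between `Σ̃_τ = φ_τ(Σ̃₀)`)
  (key `DafermosRodnianskiShlapentokhrothman2014`).
* M. Dafermos, I. Rodnianski, arXiv:1010.5132, §4.6, Prop. 4.6.1 (key `DafermosRodnianski2010KerrSmallA`).
* S. W. Hawking, G. F. R. Ellis, *The large scale structure of space-time*, CUP 1973, §4.3,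
  Lemma 4.3.1 and the conservation theorem (key `HawkingEllis1973CUP`).
* J. Sbierski, Anal. PDE 8 (2015), §2, Thm. 2.1 (energy estimate with uniform constants under
  `|∇N|, |∇g| ≤ C`) (key `Sbierski2015`).
-/

noncomputable section

open Set Filter Metric MeasureTheory
open scoped Topology Manifold ContDiff ENNReal

namespace Literature.Geometry.Lorentzian

namespace Kerr

/-! ### Bookkeeping for the weight `Kerr.dodWeight` -/

/-- The slab cutoff takes values in `[0, 1]`. [folklore] -/
theorem timeSlabCutoff_le_one (T A t : ℝ) : timeSlabCutoff T A t ≤ 1 :=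
  mul_le_one₀ (Real.smoothTransition.le_one _) (Real.smoothTransition.nonneg _)
    (Real.smoothTransition.le_one _)

/-- The weight takes values in `[0, 1]`. [folklore] -/
theorem dodWeight_le_one (M a T A ε : ℝ) (c : E3) (x : E4) : dodWeight M a T A ε c x ≤ 1 :=
  mul_le_one₀ (mul_le_one₀ (timeSlabCutoff_le_one _ _ _) (Real.smoothTransition.nonneg _)
    (Real.smoothTransition.le_one _)) (Real.smoothTransition.nonneg _)
    (Real.smoothTransition.le_one _)

/-- Points of the support set `Kerr.dodSet M a A ε c` have spatial radius at most `‖c‖ + (A + 2)`.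
[folklore] -/
theorem spatialNorm_le_of_mem_dodSet {M a A ε : ℝ} {c : E3} {x : E4}
    (hx : x ∈ dodSet M a A ε c) : E4.spatialNorm x ≤ ‖c‖ + (A + 2) := by
  obtain ⟨⟨p, ⟨-, hp⟩, rfl⟩, -⟩ := hx
  rw [E4.spatialNorm_ofTimeSpace]
  rw [mem_closedBall, dist_eq_norm] at hp
  calc ‖p.2‖ = ‖(p.2 - c) + c‖ := by rw [sub_add_cancel]
    _ ≤ ‖p.2 - c‖ + ‖c‖ := norm_add_le _ _
    _ ≤ ‖c‖ + (A + 2) := by linarith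

/-- **At time `τ` the weight `dodWeight M a τ A ε 0` is `1` on `{‖y‖ ≤ A − τ − 1} ∩
{(r − r₊) e^{−τ/(2M)} ≥ 2ε}`** (for `0 ≤ τ < A`): all three smoothed indicators are saturated.
[folklore] -/
theorem dodWeight_eq_one {M a τ A ε : ℝ} (hτ : 0 ≤ τ) (hτA : τ < A) {y : E3}
    (hy : ‖y‖ ≤ A - τ - 1) (hh : 2 * ε ≤ horizonFn M a (E4.ofTimeSpace τ y)) (hε : 0 < ε) :
    dodWeight M a τ A ε 0 (E4.ofTimeSpace τ y) = 1 := by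
  have h1 : timeSlabCutoff τ A ((E4.ofTimeSpace τ y) 0) = 1 := by
    rw [E4.ofTimeSpace_apply_zero]
    exact timeSlabCutoff_eq_one hτA (by linarith) (by linarith)
  have h2 : Real.smoothTransition (coneFn A 0 (E4.ofTimeSpace τ y)) = 1 := by
    refine Real.smoothTransition.one_of_one_le ?_
    have hn : 0 ≤ ‖y‖ := norm_nonneg y
    have hAy : ‖y‖ + 1 ≤ A - τ := by linarith
    simp only [coneFn, E4.ofTimeSpace_apply_zero, E4.spatial_ofTimeSpace, sub_zero]
    nlinarith
  have h3 : Real.smoothTransition (horizonFn M a (E4.ofTimeSpace τ y) / ε - 1) = 1 := by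
    refine Real.smoothTransition.one_of_one_le ?_
    have : 2 ≤ horizonFn M a (E4.ofTimeSpace τ y) / ε := by
      rw [le_div_iff₀ hε]; linarith
    linarith
  simp only [dodWeight, h1, h2, h3, mul_one]

/-- Where the horizon function is positive, the point lies strictly outside the event horizon.
[folklore] -/
theorem rPlus_lt_radius_of_horizonFn_pos {M a : ℝ} {x : E4} (h : 0 < horizonFn M a x) :
    rPlus M a < radius a x := by
  have hexp : 0 < Real.exp (-((2 * M)⁻¹ * x 0)) := Real.exp_pos _
  have : 0 < radius a x - rPlus M a := by
    by_contra hle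
    exact absurd h (not_lt.mpr (mul_nonpos_of_nonpos_of_nonneg (not_lt.mp hle) hexp.le))
  linarith

/-! ### Measurability and continuity of the energy densities -/

/-- The coordinate energy density `y ↦ ∑_μ (∂_μΦ)²(t, y)` of an arbitrary function on a leaf is
measurable (derivatives of arbitrary functions are measurable, Mathlib's `measurable_fderiv`).
[folklore] -/
theorem measurable_sum_sq_fderiv_ofTimeSpace (Φ : E4 → ℝ) (t : ℝ) :
    Measurable fun y : E3 ↦
      ENNReal.ofReal (∑ μ, fderiv ℝ Φ (E4.ofTimeSpace t y) (E4.basisVector μ) ^ 2) := by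
  refine ENNReal.measurable_ofReal.comp (Finset.measurable_sum _ fun μ _ ↦ ?_)
  exact ((measurable_fderiv_apply_const ℝ Φ (E4.basisVector μ)).comp
    (E4.continuous_ofTimeSpace t).measurable).pow_const 2

/-! ### The finite-in-time energy estimate on the exterior, up to the horizon -/

/-- **Finite-in-time energy estimate for the Kerr wave equation on the exterior, up to `𝓗⁺`
(coordinate form).** For subextremal `(M, a)` there are constants `C₀ > 0`, `C₁ ≥ 0` (namely
`C₀ = 18 (1 + 4M/r₊)²`, `C₁ = 192 (1 + 4M/r₊) D`, `D = D(M, a)` the global bound of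
`Kerr.exists_bound_fderiv_surgeryBackground_inverseMetric`) such that for every `Φ : ℝ⁴ → ℝ` of
class `C²` at the points of the exterior `{r > r₊}` of the ingoing Kerr–Schild chart which solves
the Kerr wave equation `∑_μ ∂_μ (g^{μν} ∂_νΦ) = 0` there, and every `τ ≥ 0`,
`∫_{{t* = τ}, r > r₊} ∑_μ (∂_μΦ)² dy ≤ C₀ e^{C₁ τ} ∫_{{t* = 0}, r > r₊} ∑_μ (∂_μΦ)² dy` in `[0, ∞]`.
This is the "finite in time energy estimate" through the leaves of a regular (horizon-crossing)
time function invoked by Dafermos–Rodnianski–Shlapentokh-Rothman (arXiv:1402.7034, §13.1.1; and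
§3.3 via Prop. 4.6.1 of arXiv:1010.5132), here for the Kerr–Schild leaves; proof by Hawking–Ellis's
weighted energy inequality (1973, §4.3, Lemma 4.3.1) with the receding weight `Kerr.dodWeight`
(module docstring). [cite: HawkingEllis1973CUP, §4.3 Lemma 4.3.1;
DafermosRodnianskiShlapentokhrothman2014, §13.1.1] -/
theorem exterior_coordEnergy_le_exp {M a : ℝ} (hMa : IsSubextremal M a) :
    ∃ C₀ C₁ : ℝ, 0 < C₀ ∧ 0 ≤ C₁ ∧ ∀ Φ : E4 → ℝ,
      (∀ x ∈ (exterior M a : Set E4), ContDiffAt ℝ 2 Φ x) →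
      (∀ x ∈ (exterior M a : Set E4),
        KerrSchild.waveOperator
          (KerrSchild.inverseMetric (fun y ↦ 2 * scalarH M a y) (nullVector a)) Φ x = 0) →
      ∀ τ : ℝ, 0 ≤ τ →
        (∫⁻ y, {y : E3 | E4.ofTimeSpace τ y ∈ exterior M a}.indicator
            (fun y ↦ ENNReal.ofReal
              (∑ μ, fderiv ℝ Φ (E4.ofTimeSpace τ y) (E4.basisVector μ) ^ 2)) y) ≤
          ENNReal.ofReal (C₀ * Real.exp (C₁ * τ)) *
            ∫⁻ y, {y : E3 | E4.ofTimeSpace 0 y ∈ exterior M a}.indicator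
              (fun y ↦ ENNReal.ofReal
                (∑ μ, fderiv ℝ Φ (E4.ofTimeSpace 0 y) (E4.basisVector μ) ^ 2)) y := by
  -- ### constants
  have hM : 0 < M := hMa.pos
  have hrp : 0 < rPlus M a := hMa.rPlus_pos
  set B := surgeryBackground M a (rPlus M a) hMa.pos.le hMa.rPlus_pos with hB
  obtain ⟨D, hD0, hD⟩ :=
    exists_bound_fderiv_surgeryBackground_inverseMetric hMa.pos.le a hMa.rPlus_pos
  have hΦb0 : 0 ≤ B.bound := (B.φ_nonneg 0).trans (B.φ_le 0)
  refine ⟨18 * (1 + B.bound) ^ 2, 192 * (1 + B.bound) * D, by positivity, by positivity,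
    fun Φ hΦ2 hsol τ hτ ↦ ?_⟩
  -- ### the equation on the surgered background
  have hsolB : ∀ x ∈ (exterior M a : Set E4),
      KerrSchild.waveOperator B.inverseMetric Φ x = 0 := by
    intro x hx
    rw [← KerrSchild.waveOperator_congr_of_eventuallyEq
      (surgeryBackground_inverseMetric_eventuallyEq M a hMa.pos.le hMa.rPlus_pos ⟨x, hx⟩) Φ]
    exact hsol x hx
  -- ### notation: densities and energies
  set P0 : E4 → ℝ := fun x ↦ KerrSchild.normalCurrent B.inverseMetric Φ x 0 with hP0
  set f : ℝ → E3 → ℝ≥0∞ := fun t y ↦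
    ENNReal.ofReal (∑ μ, fderiv ℝ Φ (E4.ofTimeSpace t y) (E4.basisVector μ) ^ 2) with hf
  have hfm : ∀ t, Measurable (f t) := fun t ↦ measurable_sum_sq_fderiv_ofTimeSpace Φ t
  set E0 : ℝ≥0∞ := ∫⁻ y, {y : E3 | E4.ofTimeSpace 0 y ∈ exterior M a}.indicator (f 0) y with hE0
  have hP0nn : ∀ x, 0 ≤ P0 x := fun x ↦ B.normalCurrent_zero_nonneg Φ x
  have hP1 : ∀ z ∈ (exterior M a : Set E4), ContDiffAt ℝ 1 P0 z := fun z hz ↦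
    B.contDiffAt_normalCurrent (hΦ2 z hz) 0
  -- pointwise comparison of `P⁰` with `∑ (∂Φ)²`
  have hlow : ∀ x, ∑ μ, fderiv ℝ Φ x (E4.basisVector μ) ^ 2 ≤ 6 * P0 x := fun x ↦
    KerrSchild.Background.sum_sq_le_six_mul_normalCurrent_zero B Φ x
  have hup : ∀ x, P0 x ≤ 3 * (1 + B.bound) ^ 2 * ∑ μ, fderiv ℝ Φ x (E4.basisVector μ) ^ 2 :=
    fun x ↦ KerrSchild.Background.normalCurrent_zero_le B Φ x
  -- ### Step 1: the estimate on `{‖y‖ ≤ R} ∩ {(r − r₊) e^{−τ/(2M)} ≥ 2ε}`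
  have hcore : ∀ R ε : ℝ, 0 ≤ R → 0 < ε →
      ∫⁻ y in {y : E3 | ‖y‖ ≤ R ∧ 2 * ε ≤ horizonFn M a (E4.ofTimeSpace τ y)}, f τ y ≤
        ENNReal.ofReal (18 * (1 + B.bound) ^ 2 * Real.exp (192 * (1 + B.bound) * D * τ)) *
          E0 := by
    intro R ε hR hε
    set A : ℝ := τ + R + 1 with hA
    have hτA : τ < A := by rw [hA]; linarith
    set W : E4 → ℝ := dodWeight M a τ A ε 0 with hW
    set K : Set E4 := dodSet M a A ε 0 with hK
    have hKc : IsCompact K := isCompact_dodSet M a A ε 0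
    have hKU : K ⊆ (exterior M a : Set E4) := dodSet_subset_exterior hrp hε
    have hWK : ∀ z, W z ≠ 0 → z ∈ K := fun z hz ↦ mem_dodSet_of_dodWeight_ne_zero hM hτA hε hz
    have hW1 : ContDiff ℝ 1 W := contDiff_dodWeight τ A 0 hrp hε
    have hW0 : ∀ z, 0 ≤ W z := dodWeight_nonneg M a τ A ε 0
    have hWle : ∀ z, W z ≤ 1 := dodWeight_le_one M a τ A ε 0
    have hsolK : ∀ z ∈ K, KerrSchild.waveOperator B.inverseMetric Φ z = 0 := fun z hz ↦
      hsolB z (hKU hz)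
    have hflux : ∀ z ∈ K, 0 ≤ z 0 → z 0 ≤ τ →
        ∑ μ, fderiv ℝ W z (E4.basisVector μ) * KerrSchild.normalCurrent B.inverseMetric Φ z μ
          ≤ 0 :=
      fun z hz hz0 hzT ↦ dodWeight_flux hMa Φ hτA hε 0 (lt_radius_of_mem_region (hKU hz)) hz0 hzT
    set ρ : ℝ := A + 2 with hρA
    have hρ : ∀ z ∈ K, E4.spatialNorm z ≤ ρ := fun z hz ↦ by
      simpa [hρA] using spatialNorm_le_of_mem_dodSet hz
    have hDK : ∀ z ∈ K, ∀ μ α β,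
        |fderiv ℝ (fun y ↦ B.inverseMetric y α β) z (E4.basisVector μ)| ≤ D :=
      fun z _ μ α β ↦ hD z μ α β
    -- Grönwall (Hawking–Ellis in weighted form)
    have hgron := B.weightedEnergy_le hKc hKU hΦ2 hW1 hW0 hWK hsolK hflux hρ hD0 hDK hτ le_rfl
    -- the weighted densities are continuous, hence integrable on the ball
    set J : ℝ → E3 → ℝ := fun t y ↦ W (E4.ofTimeSpace t y) * P0 (E4.ofTimeSpace t y) with hJ
    have hJc : ∀ t, Continuous (J t) := fun t ↦
      ((contDiff_iff_contDiffAt.mpr fun z ↦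
        contDiffAt_weight_mul hKc.isClosed hKU hW1 hWK hP1 z).continuous).comp
        (E4.continuous_ofTimeSpace t)
    have hJnn : ∀ t y, 0 ≤ J t y := fun t y ↦ mul_nonneg (hW0 _) (hP0nn _)
    have hJi : ∀ t, IntegrableOn (J t) (closedBall (0 : E3) ρ) := fun t ↦
      (hJc t).continuousOn.integrableOn_compact (isCompact_closedBall 0 ρ)
    have hI : ∀ t, ENNReal.ofReal (∫ y in closedBall (0 : E3) ρ, J t y) =
        ∫⁻ y in closedBall (0 : E3) ρ, ENNReal.ofReal (J t y) := fun t ↦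
      ofReal_integral_eq_lintegral_ofReal (hJi t) (ae_of_all _ (hJnn t))
    have hI0nn : 0 ≤ ∫ y in closedBall (0 : E3) ρ, J 0 y :=
      setIntegral_nonneg measurableSet_closedBall fun y _ ↦ hJnn 0 y
    -- the set and its properties
    set S : Set E3 := {y : E3 | ‖y‖ ≤ R ∧ 2 * ε ≤ horizonFn M a (E4.ofTimeSpace τ y)} with hS
    have hhc : Continuous fun y : E3 ↦ horizonFn M a (E4.ofTimeSpace τ y) := by
      show Continuous fun y : E3 ↦ (radius a (E4.ofTimeSpace τ y) - rPlus M a) *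
        Real.exp (-((2 * M)⁻¹ * τ))
      exact (((continuous_radius a).comp (E4.continuous_ofTimeSpace τ)).sub
        continuous_const).mul continuous_const
    have hSm : MeasurableSet S :=
      ((isClosed_le continuous_norm continuous_const).inter
        (isClosed_le continuous_const hhc)).measurableSet
    have hSsub : S ⊆ closedBall (0 : E3) ρ := by
      intro y hy
      rw [mem_closedBall, dist_zero_right]
      have := hy.1
      rw [hρA, hA]; linarith
    -- (i) lower bound at time `τ`
    have h1 : ∫⁻ y in S, f τ y ≤ ENNReal.ofReal (6 * ∫ y in closedBall (0 : E3) ρ, J τ y) := by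
      calc ∫⁻ y in S, f τ y ≤ ∫⁻ y in S, ENNReal.ofReal (6 * J τ y) := by
            refine setLIntegral_mono' hSm fun y hy ↦ ENNReal.ofReal_le_ofReal ?_
            have hWy : W (E4.ofTimeSpace τ y) = 1 :=
              dodWeight_eq_one hτ hτA (by rw [hA]; linarith [hy.1]) hy.2 hε
            have := hlow (E4.ofTimeSpace τ y)
            simp only [hJ, hWy, one_mul]
            exact this
        _ ≤ ∫⁻ y in closedBall (0 : E3) ρ, ENNReal.ofReal (6 * J τ y) := lintegral_mono_set hSsub
        _ = ENNReal.ofReal (∫ y in closedBall (0 : E3) ρ, 6 * J τ y) :=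
            (ofReal_integral_eq_lintegral_ofReal ((hJi τ).const_mul 6)
              (ae_of_all _ fun y ↦ by positivity [hJnn τ y])).symm
        _ = ENNReal.ofReal (6 * ∫ y in closedBall (0 : E3) ρ, J τ y) := by
            rw [integral_const_mul]
    -- (ii) upper bound at time `0`
    have h2 : ENNReal.ofReal (∫ y in closedBall (0 : E3) ρ, J 0 y) ≤
        ENNReal.ofReal (3 * (1 + B.bound) ^ 2) * E0 := by
      rw [hI 0]
      calc ∫⁻ y in closedBall (0 : E3) ρ, ENNReal.ofReal (J 0 y)
          ≤ ∫⁻ y in closedBall (0 : E3) ρ, {y : E3 | E4.ofTimeSpace 0 y ∈ exterior M a}.indicator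
              (fun y ↦ ENNReal.ofReal (3 * (1 + B.bound) ^ 2) * f 0 y) y := by
            refine lintegral_mono fun y ↦ ?_
            by_cases hWy : W (E4.ofTimeSpace 0 y) = 0
            · simp [hJ, hWy]
            · have hmem : E4.ofTimeSpace 0 y ∈ exterior M a := hKU (hWK _ hWy)
              rw [indicator_of_mem (show y ∈ {y : E3 | E4.ofTimeSpace 0 y ∈ exterior M a} from
                hmem), hf, ← ENNReal.ofReal_mul (by positivity)]
              refine ENNReal.ofReal_le_ofReal ?_
              calc J 0 y ≤ 1 * P0 (E4.ofTimeSpace 0 y) :=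
                    mul_le_mul_of_nonneg_right (hWle _) (hP0nn _)
                _ ≤ 3 * (1 + B.bound) ^ 2 *
                      ∑ μ, fderiv ℝ Φ (E4.ofTimeSpace 0 y) (E4.basisVector μ) ^ 2 := by
                    rw [one_mul]; exact hup _
        _ ≤ ∫⁻ y, {y : E3 | E4.ofTimeSpace 0 y ∈ exterior M a}.indicator
              (fun y ↦ ENNReal.ofReal (3 * (1 + B.bound) ^ 2) * f 0 y) y :=
            setLIntegral_le_lintegral _ _
        _ = ENNReal.ofReal (3 * (1 + B.bound) ^ 2) * E0 := by
            rw [hE0, ← lintegral_const_mul' _ _ ENNReal.ofReal_ne_top]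
            refine lintegral_congr fun y ↦ ?_
            by_cases hy : y ∈ {y : E3 | E4.ofTimeSpace 0 y ∈ exterior M a}
            · simp only [indicator_of_mem hy]
            · simp only [indicator_of_notMem hy, mul_zero]
    -- (iii) assemble with Grönwall
    have hexp0 : 0 ≤ Real.exp (192 * (1 + B.bound) * D * τ) := (Real.exp_pos _).le
    calc ∫⁻ y in S, f τ y
        ≤ ENNReal.ofReal (6 * ∫ y in closedBall (0 : E3) ρ, J τ y) := h1
      _ ≤ ENNReal.ofReal (6 * ((∫ y in closedBall (0 : E3) ρ, J 0 y) *
            Real.exp (192 * (1 + B.bound) * D * τ))) :=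
          ENNReal.ofReal_le_ofReal (mul_le_mul_of_nonneg_left hgron (by norm_num))
      _ = ENNReal.ofReal (6 * Real.exp (192 * (1 + B.bound) * D * τ)) *
            ENNReal.ofReal (∫ y in closedBall (0 : E3) ρ, J 0 y) := by
          rw [← ENNReal.ofReal_mul (by positivity)]
          congr 1; ring
      _ ≤ ENNReal.ofReal (6 * Real.exp (192 * (1 + B.bound) * D * τ)) *
            (ENNReal.ofReal (3 * (1 + B.bound) ^ 2) * E0) := by gcongr
      _ = ENNReal.ofReal (18 * (1 + B.bound) ^ 2 * Real.exp (192 * (1 + B.bound) * D * τ)) *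
            E0 := by
          rw [← mul_assoc, ← ENNReal.ofReal_mul (by positivity)]
          congr 2; ring
  -- ### Step 2: exhaust the exterior slice by `ε = 1/(n+1) → 0`, `R = n → ∞`
  set S : ℕ → Set E3 := fun n ↦
    {y : E3 | ‖y‖ ≤ (n : ℝ) ∧ 2 * (1 / ((n : ℝ) + 1)) ≤ horizonFn M a (E4.ofTimeSpace τ y)}
    with hS
  have hhc : Continuous fun y : E3 ↦ horizonFn M a (E4.ofTimeSpace τ y) := by
    show Continuous fun y : E3 ↦ (radius a (E4.ofTimeSpace τ y) - rPlus M a) *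
      Real.exp (-((2 * M)⁻¹ * τ))
    exact (((continuous_radius a).comp (E4.continuous_ofTimeSpace τ)).sub
      continuous_const).mul continuous_const
  have hSm : ∀ n, MeasurableSet (S n) := fun n ↦
    ((isClosed_le continuous_norm continuous_const).inter
      (isClosed_le continuous_const hhc)).measurableSet
  have hSmono : ∀ {n m : ℕ}, n ≤ m → S n ⊆ S m := by
    intro n m hnm y hy
    have hcast : (n : ℝ) ≤ m := Nat.cast_le.mpr hnm
    refine ⟨hy.1.trans hcast, le_trans ?_ hy.2⟩
    have h1 : (0 : ℝ) < (n : ℝ) + 1 := by positivity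
    gcongr
  have hUnion : {y : E3 | E4.ofTimeSpace τ y ∈ exterior M a} = ⋃ n, S n := by
    ext y
    simp only [mem_setOf_eq, mem_iUnion]
    constructor
    · intro hy
      have hr : rPlus M a < radius a (E4.ofTimeSpace τ y) := lt_radius_of_mem_region hy
      set h : ℝ := horizonFn M a (E4.ofTimeSpace τ y) with hh
      have hpos : 0 < h := mul_pos (sub_pos.mpr hr) (Real.exp_pos _)
      obtain ⟨n, hn⟩ := exists_nat_ge (max ‖y‖ (2 / h))
      refine ⟨n, (le_max_left _ _).trans hn, ?_⟩
      have h2 : 2 / h ≤ n := (le_max_right _ _).trans hn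
      have hn1 : (0 : ℝ) < (n : ℝ) + 1 := by positivity
      rw [div_le_iff₀ hpos] at h2
      rw [← hh, mul_one_div, div_le_iff₀ hn1]
      nlinarith
    · rintro ⟨n, -, hy⟩
      have hpos : 0 < horizonFn M a (E4.ofTimeSpace τ y) :=
        lt_of_lt_of_le (by positivity) hy
      rw [mem_exterior, max_eq_left hrp.le]
      exact rPlus_lt_radius_of_horizonFn_pos hpos
  have hind : ∀ y, {y : E3 | E4.ofTimeSpace τ y ∈ exterior M a}.indicator (f τ) y =
      ⨆ n, (S n).indicator (f τ) y := fun y ↦ by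
    rw [hUnion]; exact indicator_iUnion_apply rfl _ _ _
  have hmonof : Monotone fun n ↦ (S n).indicator (f τ) := fun n m hnm y ↦
    indicator_le_indicator_of_subset (hSmono hnm) (fun _ ↦ zero_le) y
  calc ∫⁻ y, {y : E3 | E4.ofTimeSpace τ y ∈ exterior M a}.indicator (f τ) y
      = ∫⁻ y, ⨆ n, (S n).indicator (f τ) y := lintegral_congr hind
    _ = ⨆ n, ∫⁻ y, (S n).indicator (f τ) y :=
        lintegral_iSup (fun n ↦ (hfm τ).indicator (hSm n)) hmonof
    _ = ⨆ n, ∫⁻ y in S n, f τ y := by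
        congr with n
        exact lintegral_indicator (hSm n) _
    _ ≤ ENNReal.ofReal (18 * (1 + B.bound) ^ 2 * Real.exp (192 * (1 + B.bound) * D * τ)) *
          E0 :=
        iSup_le fun n ↦ hcore (n : ℝ) (1 / ((n : ℝ) + 1)) n.cast_nonneg (by positivity)

end Kerr

/-! ### The estimate for smooth solutions on the exterior chart and for the horizon-regular class -/

/-- **Finite-in-time energy estimate through the Kerr–Schild leaves for smooth solutions of
`□_g ψ = 0` on the Kerr exterior, up to `𝓗⁺`.** For subextremal `(M, a)` there are `C₀ > 0`,
`C₁ ≥ 0` such that every smooth solution `ψ : Kerr.exterior M a → ℝ` of the wave equation (the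
prelude's d'Alembertian of `Kerr.smoothMetric`, as in gr.S24) satisfies, for all `τ ≥ 0`,
`E(τ) ≤ C₀ e^{C₁ τ} E(0)`, `E(τ) = sliceEnergy (Kerr.exterior M a) ψ τ` the coordinate energy
through `{t* = τ} ∩ {r > r₊}` (`WeightedNorms.lean`). No support hypothesis is needed (both sides
may be infinite). Coordinate form: `Kerr.exterior_coordEnergy_le_exp`, via
`Kerr.dalembertian_eq_waveOperator`. Hawking–Ellis 1973, §4.3, Lemma 4.3.1; the "finite in time
energy estimates" of Dafermos–Rodnianski–Shlapentokh-Rothman, arXiv:1402.7034, §13.1.1.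
[cite: HawkingEllis1973CUP, §4.3 Lemma 4.3.1; DafermosRodnianskiShlapentokhrothman2014, §13.1.1] -/
theorem kerr_exterior_sliceEnergy_le_exp [Kerr.Facts] [Kerr.SliceFacts] {M a : ℝ}
    (hMa : Kerr.IsSubextremal M a) :
    ∃ C₀ C₁ : ℝ, 0 < C₀ ∧ 0 ≤ C₁ ∧ ∀ ψ : Kerr.exterior M a → ℝ,
      ContMDiff 𝓘(ℝ, E4) 𝓘(ℝ, ℝ) ∞ ψ →
      (∀ x, (Kerr.smoothMetric M a (Kerr.rPlus M a)).toPseudoRiemannianMetric.dalembertian ψ x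
        = 0) →
      ∀ τ : ℝ, 0 ≤ τ →
        sliceEnergy (Kerr.exterior M a) ψ τ ≤
          ENNReal.ofReal (C₀ * Real.exp (C₁ * τ)) * sliceEnergy (Kerr.exterior M a) ψ 0 := by
  obtain ⟨C₀, C₁, hC₀, hC₁, h⟩ := Kerr.exterior_coordEnergy_le_exp hMa
  refine ⟨C₀, C₁, hC₀, hC₁, fun ψ hψ hwave τ hτ ↦ ?_⟩
  set Φ : E4 → ℝ := Function.extend Subtype.val ψ 0 with hΦ
  have hrep : ∀ y, ψ y = Φ y := extend_rep ψ
  have hΦ2 : ∀ z ∈ (Kerr.exterior M a : Set E4), ContDiffAt ℝ 2 Φ z := fun z hz ↦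
    (contDiffAt_extend hψ ⟨z, hz⟩).of_le (WithTop.coe_le_coe.mpr le_top)
  have hsol : ∀ z ∈ (Kerr.exterior M a : Set E4),
      KerrSchild.waveOperator (KerrSchild.inverseMetric (fun y ↦ 2 * Kerr.scalarH M a y)
        (Kerr.nullVector a)) Φ z = 0 := by
    intro z hz
    rw [← Kerr.dalembertian_eq_waveOperator M a (Kerr.rPlus M a) hrep ⟨z, hz⟩ (hΦ2 z hz)]
    exact hwave ⟨z, hz⟩
  have hE : ∀ t, sliceEnergy (Kerr.exterior M a) ψ t =
      ∫⁻ y, {y : E3 | E4.ofTimeSpace t y ∈ Kerr.exterior M a}.indicator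
        (fun y ↦ ENNReal.ofReal
          (∑ μ, fderiv ℝ Φ (E4.ofTimeSpace t y) (E4.basisVector μ) ^ 2)) y := fun t ↦ rfl
  rw [hE τ, hE 0]
  exact h Φ hΦ2 hsol τ hτ

/-- **Finite-in-time boundedness, `∀ T, ∃ C < ∞` form**: for subextremal `(M, a)` and every `T`
there is `C = C(M, a, T) < ∞` (namely `C₀ e^{C₁ T}`) such that every smooth solution `ψ` of
`□_g ψ = 0` on the exterior chart satisfies `E(τ) ≤ C · E(0)` for all `τ ∈ [0, T]`,
`E(τ) = sliceEnergy (Kerr.exterior M a) ψ τ`. This is the shape of the uniform boundedness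
statements of gr.S24 (`drsr_wave_boundedness_kerr`) with a constant allowed to depend on `T`; the
`T`-independence is Theorem 3.1 (23) of arXiv:1402.7034, not proved in this library.
[cite: HawkingEllis1973CUP, §4.3 Lemma 4.3.1; DafermosRodnianskiShlapentokhrothman2014, §13.1.1] -/
theorem kerr_exterior_sliceEnergy_finiteTime [Kerr.Facts] [Kerr.SliceFacts] {M a : ℝ}
    (hMa : Kerr.IsSubextremal M a) (T : ℝ) :
    ∃ C : ℝ≥0∞, C < ⊤ ∧ ∀ ψ : Kerr.exterior M a → ℝ,
      ContMDiff 𝓘(ℝ, E4) 𝓘(ℝ, ℝ) ∞ ψ →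
      (∀ x, (Kerr.smoothMetric M a (Kerr.rPlus M a)).toPseudoRiemannianMetric.dalembertian ψ x
        = 0) →
      ∀ τ : ℝ, 0 ≤ τ → τ ≤ T →
        sliceEnergy (Kerr.exterior M a) ψ τ ≤ C * sliceEnergy (Kerr.exterior M a) ψ 0 := by
  obtain ⟨C₀, C₁, hC₀, hC₁, h⟩ := kerr_exterior_sliceEnergy_le_exp hMa
  refine ⟨ENNReal.ofReal (C₀ * Real.exp (C₁ * T)), ENNReal.ofReal_lt_top,
    fun ψ hψ hwave τ hτ hτT ↦ (h ψ hψ hwave τ hτ).trans ?_⟩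
  exact mul_le_mul_left (ENNReal.ofReal_le_ofReal (mul_le_mul_of_nonneg_left
    (Real.exp_le_exp.mpr (mul_le_mul_of_nonneg_left hτT hC₁)) hC₀.le)) _

/-- **Finite-in-time boundedness through the Kerr–Schild leaves for the horizon-regular class of
`DafermosRodnianskiShlapentokhRothman2016_energyBoundedness_horizonRegular`.** For subextremal
`(M, a)`, an inner radius `r₀ ≤ r₊` and every `T` there is `C = C(M, a, T) < ∞` such that every
smooth `ψ : Kerr.region a r₀ → ℝ` (horizon-penetrating chart `{r > r₀}`) solving `□_g ψ = 0` at
the points with `r > r₊` (nothing is imposed on `{r ≤ r₊}`) satisfies `E(τ) ≤ C · E(0)` for all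
`τ ∈ [0, T]`, where `E(τ) = sliceEnergy (Kerr.exterior M a) ψ|_{r > r₊} τ` is the coordinate energy
of the restriction of `ψ` to the exterior chart through `{t* = τ} ∩ {r > r₊}` — the conclusion of
the consumer `kerr_leafEnergy_boundedness_of` of the named fact, with a `T`-dependent constant (the
`T`-independent statement is arXiv:1402.7034, Thm. 3.1 (23), §3.3, not proved here). No compact
support of the data is needed. Proof: `Kerr.exterior_coordEnergy_le_exp` for the representative of
`ψ`, which is `C²` and solves the coordinate wave equation at the exterior points
(`Kerr.dalembertian_eq_waveOperator` on the chart `Kerr.region a r₀`); the energy densities of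
`ψ|_{r > r₊}` and `ψ` agree on the open exterior.
[cite: HawkingEllis1973CUP, §4.3 Lemma 4.3.1; DafermosRodnianskiShlapentokhrothman2014, §13.1.1] -/
theorem kerr_horizonRegular_sliceEnergy_finiteTime [Kerr.Facts] [Kerr.SliceFacts] {M a r₀ : ℝ}
    (hMa : Kerr.IsSubextremal M a) (hr : r₀ ≤ Kerr.rPlus M a) (T : ℝ) :
    ∃ C : ℝ≥0∞, C < ⊤ ∧ ∀ ψ : Kerr.region a r₀ → ℝ,
      ContMDiff 𝓘(ℝ, E4) 𝓘(ℝ, ℝ) ∞ ψ →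
      (∀ x : Kerr.region a r₀, Kerr.rPlus M a < Kerr.radius a (x : E4) →
        (Kerr.smoothMetric M a r₀).toPseudoRiemannianMetric.dalembertian ψ x = 0) →
      ∀ τ : ℝ, 0 ≤ τ → τ ≤ T →
        sliceEnergy (Kerr.exterior M a)
            (fun y : Kerr.exterior M a ↦ ψ ⟨(y : E4), Kerr.region_mono a hr y.2⟩) τ ≤
          C * sliceEnergy (Kerr.exterior M a)
            (fun y : Kerr.exterior M a ↦ ψ ⟨(y : E4), Kerr.region_mono a hr y.2⟩) 0 := by
  obtain ⟨C₀, C₁, hC₀, hC₁, h⟩ := Kerr.exterior_coordEnergy_le_exp hMa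
  refine ⟨ENNReal.ofReal (C₀ * Real.exp (C₁ * T)), ENNReal.ofReal_lt_top,
    fun ψ hψ hwave τ hτ hτT ↦ ?_⟩
  set ψ' : Kerr.exterior M a → ℝ := fun y ↦ ψ ⟨(y : E4), Kerr.region_mono a hr y.2⟩ with hψ'
  set Φ : E4 → ℝ := Function.extend Subtype.val ψ 0 with hΦ
  set Φ' : E4 → ℝ := Function.extend Subtype.val ψ' 0 with hΦ'
  have hrep : ∀ y, ψ y = Φ y := extend_rep ψ
  have hrep' : ∀ y, ψ' y = Φ' y := extend_rep ψ'
  -- the two representatives agree on the open exterior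
  have hagree : ∀ z ∈ (Kerr.exterior M a : Set E4), Φ' =ᶠ[𝓝 z] Φ := by
    intro z hz
    filter_upwards [(Kerr.exterior M a).isOpen.mem_nhds hz] with w hw
    rw [← hrep' ⟨w, hw⟩, ← hrep ⟨w, Kerr.region_mono a hr hw⟩]
  have hΦ2 : ∀ z ∈ (Kerr.exterior M a : Set E4), ContDiffAt ℝ 2 Φ z := fun z hz ↦
    (contDiffAt_extend hψ ⟨z, Kerr.region_mono a hr hz⟩).of_le (WithTop.coe_le_coe.mpr le_top)
  have hsol : ∀ z ∈ (Kerr.exterior M a : Set E4),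
      KerrSchild.waveOperator (KerrSchild.inverseMetric (fun y ↦ 2 * Kerr.scalarH M a y)
        (Kerr.nullVector a)) Φ z = 0 := by
    intro z hz
    rw [← Kerr.dalembertian_eq_waveOperator M a r₀ hrep ⟨z, Kerr.region_mono a hr hz⟩ (hΦ2 z hz)]
    exact hwave _ (Kerr.lt_radius_of_mem_region hz)
  -- the energies of `ψ'` are those of the representative `Φ`
  have hE : ∀ t, sliceEnergy (Kerr.exterior M a) ψ' t =
      ∫⁻ y, {y : E3 | E4.ofTimeSpace t y ∈ Kerr.exterior M a}.indicator
        (fun y ↦ ENNReal.ofReal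
          (∑ μ, fderiv ℝ Φ (E4.ofTimeSpace t y) (E4.basisVector μ) ^ 2)) y := by
    intro t
    unfold sliceEnergy
    refine lintegral_congr fun y ↦ ?_
    by_cases hy : y ∈ {y : E3 | E4.ofTimeSpace t y ∈ Kerr.exterior M a}
    · rw [indicator_of_mem hy, indicator_of_mem hy, ← Kerr.sum_sq_fderiv_extend_eq,
        (hagree _ hy).fderiv_eq]
    · rw [indicator_of_notMem hy, indicator_of_notMem hy]
  rw [hE τ, hE 0]
  refine (h Φ hΦ2 hsol τ hτ).trans ?_
  exact mul_le_mul_left (ENNReal.ofReal_le_ofReal (mul_le_mul_of_nonneg_left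
    (Real.exp_le_exp.mpr (mul_le_mul_of_nonneg_left hτT hC₁)) hC₀.le)) _

/-! ### Time translation: the estimate between any two leaves `τ₁ ≤ τ₂` -/

namespace Kerr

/-- `(t, y) + s ∂_{t*} = (t + s, y)`. [folklore] -/
theorem ofTimeSpace_add_smul_basisVector_zero (t s : ℝ) (y : E3) :
    E4.ofTimeSpace t y + s • E4.basisVector 0 = E4.ofTimeSpace (t + s) y := by
  ext i
  refine Fin.cases ?_ (fun j ↦ ?_) i
  · simp
  · simp [Fin.succ_ne_zero]

/-- **The divergence-form wave operator commutes with translations that leave the coefficients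
invariant**: if `G(y + v) = G(y)` for all `y`, then `□_G (Φ ∘ (· + v)) (x) = (□_G Φ)(x + v)`
(Fréchet derivatives commute with translations, Mathlib's `fderiv_comp_add_right`). For the Kerr
coefficients and `v ∥ ∂_{t*}` this is the statement that `∂_{t*}` is a Killing field
(Dafermos–Rodnianski–Shlapentokh-Rothman arXiv:1402.7034, §2.2.2). [folklore] -/
theorem _root_.Literature.Geometry.Lorentzian.KerrSchild.waveOperator_comp_add_right
    {G : E4 → Fin 4 → Fin 4 → ℝ} {v : E4} (hG : ∀ y μ ν, G (y + v) μ ν = G y μ ν)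
    (Φ : E4 → ℝ) (x : E4) :
    KerrSchild.waveOperator G (fun y ↦ Φ (y + v)) x = KerrSchild.waveOperator G Φ (x + v) := by
  unfold KerrSchild.waveOperator
  refine Finset.sum_congr rfl fun μ _ ↦ ?_
  set g : E4 → ℝ := fun z ↦ ∑ ν, G z μ ν * fderiv ℝ Φ z (E4.basisVector ν) with hg
  have h : (fun y ↦ ∑ ν, G y μ ν * fderiv ℝ (fun z ↦ Φ (z + v)) y (E4.basisVector ν)) =
      fun y ↦ g (y + v) := by
    funext y
    simp only [hg, fderiv_comp_add_right, hG]
  have key : fderiv ℝ (fun y ↦ g (y + v)) x = fderiv ℝ g (x + v) := fderiv_comp_add_right v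
  rw [h, key]

/-- The Kerr coefficients `g^{μν} = η^{μν} − 2H ℓ^μ ℓ^ν` are invariant under `t*`-translations
(stationarity; `Kerr.scalarH_add_smul_basisVector_zero`, `Kerr.nullVector_add_smul_basisVector_zero`).
[cite: KerrSchild1965, §2] -/
theorem kerrSchild_inverseMetric_add_smul_basisVector_zero (M a : ℝ) (y : E4) (s : ℝ)
    (μ ν : Fin 4) :
    KerrSchild.inverseMetric (fun z ↦ 2 * scalarH M a z) (nullVector a) (y + s • E4.basisVector 0)
        μ ν =
      KerrSchild.inverseMetric (fun z ↦ 2 * scalarH M a z) (nullVector a) y μ ν := by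
  simp only [KerrSchild.inverseMetric, scalarH_add_smul_basisVector_zero,
    nullVector_add_smul_basisVector_zero]

/-- **Finite-in-time energy estimate between any two Kerr–Schild leaves `τ₁ ≤ τ₂`** (coordinate
form): with the constants of `Kerr.exterior_coordEnergy_le_exp`,
`∫_{{t* = τ₂}, r > r₊} ∑(∂Φ)² dy ≤ C₀ e^{C₁ (τ₂ − τ₁)} ∫_{{t* = τ₁}, r > r₊} ∑(∂Φ)² dy` for every
`Φ` of class `C²` at the exterior points solving the Kerr wave equation there. Proof: the estimate
from `0` to `τ₂ − τ₁` for the translate `Φ(· + τ₁ ∂_{t*})`, which solves the same equation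
(`KerrSchild.waveOperator_comp_add_right`, stationarity of the coefficients) on the
translation-invariant exterior `{r > r₊}`. Hawking–Ellis 1973, §4.3, Lemma 4.3.1;
arXiv:1402.7034, §13.1.1, §2.2.2. [cite: HawkingEllis1973CUP, §4.3 Lemma 4.3.1;
DafermosRodnianskiShlapentokhrothman2014, §13.1.1] -/
theorem exterior_coordEnergy_le_exp_of_le {M a : ℝ} (hMa : IsSubextremal M a) :
    ∃ C₀ C₁ : ℝ, 0 < C₀ ∧ 0 ≤ C₁ ∧ ∀ Φ : E4 → ℝ,
      (∀ x ∈ (exterior M a : Set E4), ContDiffAt ℝ 2 Φ x) →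
      (∀ x ∈ (exterior M a : Set E4),
        KerrSchild.waveOperator
          (KerrSchild.inverseMetric (fun y ↦ 2 * scalarH M a y) (nullVector a)) Φ x = 0) →
      ∀ τ₁ τ₂ : ℝ, τ₁ ≤ τ₂ →
        (∫⁻ y, {y : E3 | E4.ofTimeSpace τ₂ y ∈ exterior M a}.indicator
            (fun y ↦ ENNReal.ofReal
              (∑ μ, fderiv ℝ Φ (E4.ofTimeSpace τ₂ y) (E4.basisVector μ) ^ 2)) y) ≤
          ENNReal.ofReal (C₀ * Real.exp (C₁ * (τ₂ - τ₁))) *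
            ∫⁻ y, {y : E3 | E4.ofTimeSpace τ₁ y ∈ exterior M a}.indicator
              (fun y ↦ ENNReal.ofReal
                (∑ μ, fderiv ℝ Φ (E4.ofTimeSpace τ₁ y) (E4.basisVector μ) ^ 2)) y := by
  obtain ⟨C₀, C₁, hC₀, hC₁, h⟩ := exterior_coordEnergy_le_exp hMa
  refine ⟨C₀, C₁, hC₀, hC₁, fun Φ hΦ2 hsol τ₁ τ₂ hτ ↦ ?_⟩
  set v : E4 := τ₁ • E4.basisVector 0 with hv
  set Ψ : E4 → ℝ := fun y ↦ Φ (y + v) with hΨ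
  -- the exterior is invariant under `t*`-translations
  have hmem : ∀ x : E4, x ∈ (exterior M a : Set E4) → x + v ∈ (exterior M a : Set E4) := by
    intro x hx
    rw [SetLike.mem_coe, mem_exterior] at hx ⊢
    rwa [hv, radius_add_time_smul_basisVector]
  have hΨ2 : ∀ x ∈ (exterior M a : Set E4), ContDiffAt ℝ 2 Ψ x := fun x hx ↦
    (hΦ2 (x + v) (hmem x hx)).comp x (contDiffAt_id.add contDiffAt_const)
  have hΨsol : ∀ x ∈ (exterior M a : Set E4), KerrSchild.waveOperator
      (KerrSchild.inverseMetric (fun y ↦ 2 * scalarH M a y) (nullVector a)) Ψ x = 0 := by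
    intro x hx
    rw [hΨ, KerrSchild.waveOperator_comp_add_right
      (fun y μ ν ↦ kerrSchild_inverseMetric_add_smul_basisVector_zero M a y τ₁ μ ν)]
    exact hsol (x + v) (hmem x hx)
  -- the energies of `Ψ` through `{t* = t}` are those of `Φ` through `{t* = t + τ₁}`
  have hE : ∀ t, (∫⁻ y, {y : E3 | E4.ofTimeSpace t y ∈ exterior M a}.indicator
      (fun y ↦ ENNReal.ofReal (∑ μ, fderiv ℝ Ψ (E4.ofTimeSpace t y) (E4.basisVector μ) ^ 2)) y)
      = ∫⁻ y, {y : E3 | E4.ofTimeSpace (t + τ₁) y ∈ exterior M a}.indicator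
          (fun y ↦ ENNReal.ofReal
            (∑ μ, fderiv ℝ Φ (E4.ofTimeSpace (t + τ₁) y) (E4.basisVector μ) ^ 2)) y := by
    intro t
    refine lintegral_congr fun y ↦ ?_
    have hset : (y ∈ {y : E3 | E4.ofTimeSpace t y ∈ exterior M a}) ↔
        (y ∈ {y : E3 | E4.ofTimeSpace (t + τ₁) y ∈ exterior M a}) := by
      simp only [mem_setOf_eq, ofTimeSpace_mem_exterior_iff]
    have hval : ∀ μ, fderiv ℝ Ψ (E4.ofTimeSpace t y) (E4.basisVector μ) =
        fderiv ℝ Φ (E4.ofTimeSpace (t + τ₁) y) (E4.basisVector μ) := fun μ ↦ by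
      rw [hΨ, fderiv_comp_add_right, hv, ofTimeSpace_add_smul_basisVector_zero]
    by_cases hy : y ∈ {y : E3 | E4.ofTimeSpace t y ∈ exterior M a}
    · rw [indicator_of_mem hy, indicator_of_mem (hset.mp hy)]
      simp only [hval]
    · rw [indicator_of_notMem hy, indicator_of_notMem (fun h' ↦ hy (hset.mpr h'))]
  have hmain := h Ψ hΨ2 hΨsol (τ₂ - τ₁) (sub_nonneg.mpr hτ)
  rw [hE, hE, zero_add, sub_add_cancel] at hmain
  exact hmain

end Kerr

/-- **Finite-in-time energy estimate between any two leaves `τ₁ ≤ τ₂` for smooth solutions on the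
exterior chart**: `E(τ₂) ≤ C₀ e^{C₁ (τ₂ − τ₁)} E(τ₁)`, `E(τ) = sliceEnergy (Kerr.exterior M a) ψ τ`,
with the constants of `kerr_exterior_sliceEnergy_le_exp` (time-translation invariance of the Kerr
exterior and of its wave operator, `Kerr.exterior_coordEnergy_le_exp_of_le`). Hawking–Ellis 1973,
§4.3, Lemma 4.3.1; Dafermos–Rodnianski–Shlapentokh-Rothman arXiv:1402.7034, §13.1.1 ("finite in
time energy estimates"), §2.2.2 (`T = ∂_{t*}` Killing). [cite: HawkingEllis1973CUP, §4.3 Lemma 4.3.1;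
DafermosRodnianskiShlapentokhrothman2014, §13.1.1] -/
theorem kerr_exterior_sliceEnergy_le_exp_of_le [Kerr.Facts] [Kerr.SliceFacts] {M a : ℝ}
    (hMa : Kerr.IsSubextremal M a) :
    ∃ C₀ C₁ : ℝ, 0 < C₀ ∧ 0 ≤ C₁ ∧ ∀ ψ : Kerr.exterior M a → ℝ,
      ContMDiff 𝓘(ℝ, E4) 𝓘(ℝ, ℝ) ∞ ψ →
      (∀ x, (Kerr.smoothMetric M a (Kerr.rPlus M a)).toPseudoRiemannianMetric.dalembertian ψ x
        = 0) →
      ∀ τ₁ τ₂ : ℝ, τ₁ ≤ τ₂ →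
        sliceEnergy (Kerr.exterior M a) ψ τ₂ ≤
          ENNReal.ofReal (C₀ * Real.exp (C₁ * (τ₂ - τ₁))) * sliceEnergy (Kerr.exterior M a) ψ τ₁ := by
  obtain ⟨C₀, C₁, hC₀, hC₁, h⟩ := Kerr.exterior_coordEnergy_le_exp_of_le hMa
  refine ⟨C₀, C₁, hC₀, hC₁, fun ψ hψ hwave τ₁ τ₂ hτ ↦ ?_⟩
  set Φ : E4 → ℝ := Function.extend Subtype.val ψ 0 with hΦ
  have hrep : ∀ y, ψ y = Φ y := extend_rep ψ
  have hΦ2 : ∀ z ∈ (Kerr.exterior M a : Set E4), ContDiffAt ℝ 2 Φ z := fun z hz ↦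
    (contDiffAt_extend hψ ⟨z, hz⟩).of_le (WithTop.coe_le_coe.mpr le_top)
  have hsol : ∀ z ∈ (Kerr.exterior M a : Set E4),
      KerrSchild.waveOperator (KerrSchild.inverseMetric (fun y ↦ 2 * Kerr.scalarH M a y)
        (Kerr.nullVector a)) Φ z = 0 := by
    intro z hz
    rw [← Kerr.dalembertian_eq_waveOperator M a (Kerr.rPlus M a) hrep ⟨z, hz⟩ (hΦ2 z hz)]
    exact hwave ⟨z, hz⟩
  have hE : ∀ t, sliceEnergy (Kerr.exterior M a) ψ t =
      ∫⁻ y, {y : E3 | E4.ofTimeSpace t y ∈ Kerr.exterior M a}.indicator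
        (fun y ↦ ENNReal.ofReal
          (∑ μ, fderiv ℝ Φ (E4.ofTimeSpace t y) (E4.basisVector μ) ^ 2)) y := fun t ↦ rfl
  rw [hE τ₂, hE τ₁]
  exact h Φ hΦ2 hsol τ₁ τ₂ hτ

/-! ## Part II. Graph leaves `{t* = s + F(y)}`: towards the finite-in-time estimate for the
translates of a uniformly spacelike graph (the foliation `Σ̃_s = φ_s(Σ̃₀)` of the named fact)

### Pointwise bounds: the size of the current and the coercivity of the flux through a graph -/

namespace KerrSchild.Background

/-- **`|P^μ| ≤ 6 (1 + Φ)² ∑_κ (∂_κw)²`** for every component of the `dt`-current on a background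
(`|g^{μν}| ≤ 1 + Φ`, `(∑|p|)² ≤ 4 ∑ p²`). [folklore] -/
theorem abs_normalCurrent_le (B : Background) (w : E4 → ℝ) (x : E4) (μ : Fin 4) :
    |normalCurrent B.inverseMetric w x μ| ≤
      6 * (1 + B.bound) ^ 2 * ∑ κ, fderiv ℝ w x (E4.basisVector κ) ^ 2 := by
  set p : Fin 4 → ℝ := fun κ ↦ fderiv ℝ w x (E4.basisVector κ) with hp
  set S : ℝ := ∑ κ, p κ ^ 2 with hS
  set Tt : ℝ := ∑ κ, |p κ| with hT
  have hΦ0 : 0 ≤ B.bound := (B.φ_nonneg x).trans (B.φ_le x)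
  have hA : ∀ α β, |B.inverseMetric x α β| ≤ 1 + B.bound := B.abs_inverseMetric_le x
  have hT0 : 0 ≤ Tt := Finset.sum_nonneg fun _ _ ↦ abs_nonneg _
  have hsq : Tt ^ 2 ≤ 4 * S := Kerr.sq_sum_abs_le_four_mul p
  have h1 : ∀ α, |∑ ν, B.inverseMetric x α ν * p ν| ≤ (1 + B.bound) * Tt := by
    intro α
    calc _ ≤ ∑ ν, |B.inverseMetric x α ν * p ν| := Finset.abs_sum_le_sum_abs _ _
      _ ≤ ∑ ν, (1 + B.bound) * |p ν| := Finset.sum_le_sum fun ν _ ↦ by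
          rw [abs_mul]; exact mul_le_mul_of_nonneg_right (hA α ν) (abs_nonneg _)
      _ = (1 + B.bound) * Tt := by rw [hT, Finset.mul_sum]
  have h2 : |∑ α, ∑ β, B.inverseMetric x α β * p α * p β| ≤ (1 + B.bound) * Tt * Tt :=
    Kerr.abs_sum_sum_mul_mul_le _ p p hA
  have hP : normalCurrent B.inverseMetric w x μ =
      (∑ ν, B.inverseMetric x μ ν * p ν) * (∑ α, B.inverseMetric x 0 α * p α) -
        2⁻¹ * B.inverseMetric x 0 μ * ∑ α, ∑ β, B.inverseMetric x α β * p α * p β := rfl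
  rw [hP]
  calc |(∑ ν, B.inverseMetric x μ ν * p ν) * (∑ α, B.inverseMetric x 0 α * p α) -
        2⁻¹ * B.inverseMetric x 0 μ * ∑ α, ∑ β, B.inverseMetric x α β * p α * p β|
      ≤ |(∑ ν, B.inverseMetric x μ ν * p ν) * (∑ α, B.inverseMetric x 0 α * p α)| +
          |2⁻¹ * B.inverseMetric x 0 μ * ∑ α, ∑ β, B.inverseMetric x α β * p α * p β| :=
        abs_sub _ _
    _ ≤ (1 + B.bound) * Tt * ((1 + B.bound) * Tt) +
          2⁻¹ * (1 + B.bound) * ((1 + B.bound) * Tt * Tt) := by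
        refine add_le_add ?_ ?_
        · rw [abs_mul]
          exact mul_le_mul (h1 μ) (h1 0) (abs_nonneg _) (by positivity)
        · rw [abs_mul, abs_mul, abs_of_pos (by norm_num : (0 : ℝ) < 2⁻¹)]
          exact mul_le_mul (mul_le_mul_of_nonneg_left (hA 0 μ) (by norm_num)) h2
            (abs_nonneg _) (by positivity)
    _ = 3 / 2 * (1 + B.bound) ^ 2 * Tt ^ 2 := by ring
    _ ≤ 3 / 2 * (1 + B.bound) ^ 2 * (4 * S) := by gcongr
    _ = 6 * (1 + B.bound) ^ 2 * S := by ring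

/-- **Coercivity of the energy flux through a uniformly spacelike graph.** For a height function
`F` with `∑_i (∂_iF)² ≤ (1 − c)²`, `0 < c ≤ 1`, at `y`, the flux density of the `dt`-current
through the graph `{t = τ + F}` with conormal `n = dt − dF = (1, −∂₁F, −∂₂F, −∂₃F)`
(`Kerr.graphConormal`) dominates `c` times the density through the leaf `{t = const}`:
`∑_μ n_μ P^μ ≥ c P⁰ (≥ 0)`. Proof: `n − c dt = (1 − c)(dt − dF/(1 − c))` is a nonnegative multiple
of a cone conormal (`coneCovector_causal`, `|∇F|/(1 − c) ≤ 1`), hence has nonnegative flux by the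
dominant energy condition (`sum_smul_mul_normalCurrent_nonneg`). Hawking–Ellis 1973, §4.3,
Lemma 4.3.1; for Kerr–Schild graphs of slope `< 1` cf. `Kerr.IsAdmissibleHeight`
(arXiv:1010.5132, Def. 4.1 (i)). [cite: HawkingEllis1973CUP, §4.3 Lemma 4.3.1] -/
theorem mul_normalCurrent_zero_le_graphFlux (B : Background) (w : E4 → ℝ) (x : E4) {F : E3 → ℝ}
    {y : E3} {c : ℝ} (hc : 0 < c) (hc1 : c ≤ 1)
    (hF : ∑ i, Kerr.partialE3 F y i ^ 2 ≤ (1 - c) ^ 2) :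
    c * normalCurrent B.inverseMetric w x 0 ≤
      ∑ μ, Kerr.graphConormal F y μ * normalCurrent B.inverseMetric w x μ := by
  have e1 : Kerr.graphConormal F y 1 = -Kerr.partialE3 F y 0 := rfl
  have e2 : Kerr.graphConormal F y 2 = -Kerr.partialE3 F y 1 := rfl
  have e3 : Kerr.graphConormal F y 3 = -Kerr.partialE3 F y 2 := rfl
  simp only [Fin.sum_univ_three] at hF
  rcases eq_or_lt_of_le hc1 with rfl | hc1'
  · -- `c = 1`: the graph is a leaf, `∂F = 0`
    have h0 : Kerr.partialE3 F y 0 = 0 ∧ Kerr.partialE3 F y 1 = 0 ∧ Kerr.partialE3 F y 2 = 0 := by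
      norm_num at hF
      refine ⟨?_, ?_, ?_⟩ <;> nlinarith [sq_nonneg (Kerr.partialE3 F y 0),
        sq_nonneg (Kerr.partialE3 F y 1), sq_nonneg (Kerr.partialE3 F y 2)]
    simp only [Fin.sum_univ_four, Kerr.graphConormal_zero, e1, e2, e3, h0.1, h0.2.1, h0.2.2,
      neg_zero, zero_mul, add_zero, one_mul, le_refl]
  · have h1c : 0 < 1 - c := sub_pos.mpr hc1'
    set ν : Fin 4 → ℝ := Fin.cases 1 (fun i ↦ -Kerr.partialE3 F y i / (1 - c)) with hν
    have hν0 : ν 0 = 1 := rfl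
    have n1 : ν 1 = -Kerr.partialE3 F y 0 / (1 - c) := rfl
    have n2 : ν 2 = -Kerr.partialE3 F y 1 / (1 - c) := rfl
    have n3 : ν 3 = -Kerr.partialE3 F y 2 / (1 - c) := rfl
    have hn : ν 1 ^ 2 + ν 2 ^ 2 + ν 3 ^ 2 ≤ 1 := by
      rw [n1, n2, n3, div_pow, div_pow, div_pow, neg_sq, neg_sq, neg_sq, ← add_div, ← add_div,
        div_le_one (by positivity)]
      exact hF
    obtain ⟨hcausal, horient⟩ := B.coneCovector_causal x ν hν0 hn
    have h := B.sum_smul_mul_normalCurrent_nonneg w x ν hcausal horient h1c.le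
    have hid : ∑ μ, (1 - c) * ν μ * normalCurrent B.inverseMetric w x μ =
        (∑ μ, Kerr.graphConormal F y μ * normalCurrent B.inverseMetric w x μ) -
          c * normalCurrent B.inverseMetric w x 0 := by
      simp only [Fin.sum_univ_four, hν0, n1, n2, n3, Kerr.graphConormal_zero, e1, e2, e3]
      field_simp
      ring
    linarith

/-- **Upper bound for the graph flux**: `|∑_μ n_μ P^μ| ≤ 24 (1 + Φ)² ∑(∂w)²` when `|∂_iF| ≤ 1`
(`|n_μ| ≤ 1`, `abs_normalCurrent_le`). [folklore] -/
theorem abs_graphFlux_le (B : Background) (w : E4 → ℝ) (x : E4) {F : E3 → ℝ} {y : E3}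
    (hF : ∀ i, |Kerr.partialE3 F y i| ≤ 1) :
    |∑ μ, Kerr.graphConormal F y μ * normalCurrent B.inverseMetric w x μ| ≤
      24 * (1 + B.bound) ^ 2 * ∑ κ, fderiv ℝ w x (E4.basisVector κ) ^ 2 := by
  have hn : ∀ μ, |Kerr.graphConormal F y μ| ≤ 1 := by
    intro μ
    refine Fin.cases ?_ (fun i ↦ ?_) μ
    · simp
    · rw [Kerr.graphConormal_succ, abs_neg]; exact hF i
  have hS : 0 ≤ ∑ κ, fderiv ℝ w x (E4.basisVector κ) ^ 2 := Finset.sum_nonneg fun _ _ ↦ sq_nonneg _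
  have hΦ0 : 0 ≤ B.bound := (B.φ_nonneg x).trans (B.φ_le x)
  calc |∑ μ, Kerr.graphConormal F y μ * normalCurrent B.inverseMetric w x μ|
      ≤ ∑ μ, |Kerr.graphConormal F y μ * normalCurrent B.inverseMetric w x μ| :=
        Finset.abs_sum_le_sum_abs _ _
    _ ≤ ∑ _μ : Fin 4, 1 * (6 * (1 + B.bound) ^ 2 * ∑ κ, fderiv ℝ w x (E4.basisVector κ) ^ 2) := by
        refine Finset.sum_le_sum fun μ _ ↦ ?_
        rw [abs_mul]
        exact mul_le_mul (hn μ) (B.abs_normalCurrent_le w x μ) (abs_nonneg _) zero_le_one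
    _ = 24 * (1 + B.bound) ^ 2 * ∑ κ, fderiv ℝ w x (E4.basisVector κ) ^ 2 := by
        simp only [Finset.sum_const, Finset.card_univ, Fintype.card_fin, nsmul_eq_mul]
        push_cast
        ring

end KerrSchild.Background

/-! ### The weight adapted to a graph foliation: cone, upper time cutoff and receding horizon factor -/

namespace Kerr

/-- **The graph weight** `W(x) = χ(A − x⁰) · χ(u₁(x)) · χ(u₂(x)/ε − 1)`: a smoothed indicator of
`{x⁰ < A} ∩ {‖x⃗‖ < A − x⁰} ∩ {r − r₊ > ε e^{x⁰/(2M)}}` — the weight `Kerr.dodWeight` with the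
two-sided slab cutoff in time replaced by an *upper* cutoff only (which always decreases along the
energy flow), so that the flux condition holds at all points and the region may be swept by the
translates of a graph reaching arbitrarily far into the past. Hawking–Ellis 1973, §4.3 (the region
`𝒰` of Lemma 4.3.1). [cite: HawkingEllis1973CUP, §4.3 Lemma 4.3.1] -/
def graphWeight (M a A ε : ℝ) (x : E4) : ℝ :=
  Real.smoothTransition (A - x 0) * Real.smoothTransition (coneFn A 0 x) *
    Real.smoothTransition (horizonFn M a x / ε - 1)

/-- `0 ≤ W`. [folklore] -/
theorem graphWeight_nonneg (M a A ε : ℝ) (x : E4) : 0 ≤ graphWeight M a A ε x :=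
  mul_nonneg (mul_nonneg (Real.smoothTransition.nonneg _) (Real.smoothTransition.nonneg _))
    (Real.smoothTransition.nonneg _)

/-- `W ≤ 1`. [folklore] -/
theorem graphWeight_le_one (M a A ε : ℝ) (x : E4) : graphWeight M a A ε x ≤ 1 :=
  mul_le_one₀ (mul_le_one₀ (Real.smoothTransition.le_one _) (Real.smoothTransition.nonneg _)
    (Real.smoothTransition.le_one _)) (Real.smoothTransition.nonneg _)
    (Real.smoothTransition.le_one _)

/-- The graph weight is smooth on `ℝ⁴` (for `r₊ > 0`, `ε > 0`). [folklore] -/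
theorem contDiff_graphWeight {M a : ℝ} (A : ℝ) {ε : ℝ} (hr : 0 < rPlus M a) (hε : 0 < ε)
    {n : ℕ∞} : ContDiff ℝ n (graphWeight M a A ε) :=
  ((Real.smoothTransition.contDiff.comp (contDiff_const.sub contDiff_apply_zero)).mul
    (Real.smoothTransition.contDiff.comp (contDiff_coneFn A 0))).mul (contDiff_horizonFactor hr hε)

/-- **Where the graph weight is nonzero**: `x⁰ < A`, `‖x⃗‖ < A − x⁰` and
`ε e^{x⁰/(2M)} < r − r₊`. [folklore] -/
theorem mem_of_graphWeight_ne_zero {M a A ε : ℝ} (hε : 0 < ε) {x : E4}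
    (hx : graphWeight M a A ε x ≠ 0) :
    x 0 < A ∧ E4.spatialNorm x < A - x 0 ∧
      ε * Real.exp ((2 * M)⁻¹ * x 0) < radius a x - rPlus M a := by
  have h1 : Real.smoothTransition (A - x 0) ≠ 0 := fun h ↦ hx (by simp [graphWeight, h])
  have h2 : Real.smoothTransition (coneFn A 0 x) ≠ 0 := fun h ↦ hx (by simp [graphWeight, h])
  have h3 : Real.smoothTransition (horizonFn M a x / ε - 1) ≠ 0 := fun h ↦
    hx (by simp [graphWeight, h])
  have hA : x 0 < A := by
    by_contra h
    exact h1 (Real.smoothTransition.zero_of_nonpos (by linarith))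
  refine ⟨hA, ?_, ?_⟩
  · have hcone : 0 < coneFn A 0 x := by
      by_contra h
      exact h2 (Real.smoothTransition.zero_of_nonpos (not_lt.mp h))
    have hAx : 0 ≤ A - x 0 := by linarith
    refine lt_of_pow_lt_pow_left₀ 2 hAx ?_
    have : 0 < (A - x 0) ^ 2 - ‖E4.spatial x - 0‖ ^ 2 := hcone
    rw [sub_zero] at this
    show E4.spatialNorm x ^ 2 < (A - x 0) ^ 2
    unfold E4.spatialNorm
    linarith
  · have hh : 0 < horizonFn M a x / ε - 1 := by
      by_contra h
      exact h3 (Real.smoothTransition.zero_of_nonpos (not_lt.mp h))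
    have hh' : ε < horizonFn M a x := by
      have : 1 < horizonFn M a x / ε := by linarith
      rwa [lt_div_iff₀ hε, one_mul] at this
    have hexp : 0 < Real.exp ((2 * M)⁻¹ * x 0) := Real.exp_pos _
    calc ε * Real.exp ((2 * M)⁻¹ * x 0)
        < horizonFn M a x * Real.exp ((2 * M)⁻¹ * x 0) := mul_lt_mul_of_pos_right hh' hexp
      _ = radius a x - rPlus M a := by
          rw [horizonFn, mul_assoc, ← Real.exp_add, neg_add_cancel, Real.exp_zero, mul_one]

/-- **The support set of the graph weight**: `{x⁰ ≤ A} ∩ {‖x⃗‖ ≤ A − x⁰} ∩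
{r ≥ r₊ + ε e^{x⁰/(2M)}}` — closed (not compact: it reaches arbitrarily far into the past), and
contained in the open exterior for `ε > 0`. [folklore] -/
def graphWeightSet (M a A ε : ℝ) : Set E4 :=
  {x | x 0 ≤ A ∧ E4.spatialNorm x ≤ A - x 0 ∧
    rPlus M a + ε * Real.exp ((2 * M)⁻¹ * x 0) ≤ radius a x}

/-- The support set is closed. [folklore] -/
theorem isClosed_graphWeightSet (M a A ε : ℝ) : IsClosed (graphWeightSet M a A ε) := by
  have h0 : Continuous fun x : E4 ↦ x 0 := (contDiff_apply_zero (n := 0)).continuous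
  have hsn : Continuous fun x : E4 ↦ E4.spatialNorm x := continuous_norm.comp E4.spatial.continuous
  refine (isClosed_le h0 continuous_const).inter ((isClosed_le hsn (continuous_const.sub h0)).inter
    (isClosed_le (continuous_const.add (continuous_const.mul
      (Real.continuous_exp.comp (continuous_const.mul h0)))) (continuous_radius a)))

/-- The support set lies in the open exterior `{r > r₊}` (for `r₊ > 0`, `ε > 0`). [folklore] -/
theorem graphWeightSet_subset_exterior {M a A ε : ℝ} (hr : 0 < rPlus M a) (hε : 0 < ε) :
    graphWeightSet M a A ε ⊆ (exterior M a : Set E4) := by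
  rintro x ⟨-, -, hx⟩
  rw [SetLike.mem_coe, mem_exterior, max_eq_left hr.le]
  have : 0 < ε * Real.exp ((2 * M)⁻¹ * x 0) := mul_pos hε (Real.exp_pos _)
  linarith

/-- `{W ≠ 0}` lies in the support set. [folklore] -/
theorem mem_graphWeightSet_of_ne_zero {M a A ε : ℝ} (hε : 0 < ε) {x : E4}
    (hx : graphWeight M a A ε x ≠ 0) : x ∈ graphWeightSet M a A ε := by
  obtain ⟨hA, hcone, hhor⟩ := mem_of_graphWeight_ne_zero (M := M) (a := a) hε hx
  exact ⟨hA.le, hcone.le, by linarith⟩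

/-- On the support set, in the slab between the graph-times `0` and `T` of a height function of
slope `≤ 1 − c` (so `F(x⃗) ≥ F(0) − (1 − c)‖x⃗‖`), the spatial radius is bounded:
`‖x⃗‖ ≤ (A − F(0))/c`. [folklore] -/
theorem spatialNorm_le_of_mem_graphWeightSet {M a A ε : ℝ} {x : E4} (hx : x ∈ graphWeightSet M a A ε)
    {F : E3 → ℝ} {c : ℝ} (hc : 0 < c) (hFlip : ∀ y : E3, F 0 - (1 - c) * ‖y‖ ≤ F y)
    (hslab : F (E4.spatial x) ≤ x 0) : E4.spatialNorm x ≤ (A - F 0) / c := by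
  obtain ⟨-, hcone, -⟩ := hx
  have h := hFlip (E4.spatial x)
  rw [le_div_iff₀ hc]
  have : E4.spatialNorm x = ‖E4.spatial x‖ := rfl
  nlinarith

/-- **The graph weight decreases along the energy flow, everywhere.** For subextremal `(M, a)`,
`ε > 0` and every `x` with `r > 0`... in fact every `x`: if `W(x) = 0` then `dW(x) = 0` (`W ≥ 0`
has a minimum there); otherwise `x⁰ < A` and `r > r₊`, and
`dW = χ(u₁)χ_h d[χ(A − t)] + χ(A − t)χ_h d[χ(u₁)] + χ(A − t)χ(u₁) d[χ_h]` where the first flux is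
`−χ'(A − x⁰) P⁰ ≤ 0` and the other two have a sign by `Kerr.coneFactor_flux`,
`Kerr.horizonFactor_flux`. Hawking–Ellis 1973, §4.3, Lemma 4.3.1.
[cite: HawkingEllis1973CUP, §4.3 Lemma 4.3.1] -/
theorem graphWeight_flux {M a : ℝ} (hMa : IsSubextremal M a) (w : E4 → ℝ) (A : ℝ) {ε : ℝ}
    (hε : 0 < ε) (x : E4) :
    ∑ μ, fderiv ℝ (graphWeight M a A ε) x (E4.basisVector μ) *
      KerrSchild.normalCurrent
        (surgeryBackground M a (rPlus M a) hMa.pos.le hMa.rPlus_pos).inverseMetric w x μ ≤ 0 := by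
  set B := surgeryBackground M a (rPlus M a) hMa.pos.le hMa.rPlus_pos with hB
  have hrp : 0 < rPlus M a := hMa.rPlus_pos
  by_cases hW : graphWeight M a A ε x = 0
  · -- a minimum of `W ≥ 0`
    have hmin : IsLocalMin (graphWeight M a A ε) x :=
      Filter.Eventually.of_forall fun y ↦ by rw [hW]; exact graphWeight_nonneg M a A ε y
    rw [hmin.fderiv_eq_zero]
    simp
  obtain ⟨hxA, -, hhor⟩ := mem_of_graphWeight_ne_zero (M := M) (a := a) hε hW
  have hx : rPlus M a < radius a x := by
    have : 0 < ε * Real.exp ((2 * M)⁻¹ * x 0) := mul_pos hε (Real.exp_pos _)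
    linarith
  have hxpos : 0 < radius a x := hrp.trans hx
  set U₀ : E4 → ℝ := fun y ↦ Real.smoothTransition (A - y 0) with hU₀
  set W₁ : E4 → ℝ := fun y ↦ Real.smoothTransition (coneFn A 0 y) with hW₁
  set W₂ : E4 → ℝ := fun y ↦ Real.smoothTransition (horizonFn M a y / ε - 1) with hW₂
  have hWfun : graphWeight M a A ε = fun y ↦ U₀ y * W₁ y * W₂ y := rfl
  have hU₀d : DifferentiableAt ℝ U₀ x :=
    ((Real.smoothTransition.contDiff.comp (contDiff_const.sub contDiff_apply_zero)
      (n := 1)).differentiable (by simp)) x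
  have hW₁d : DifferentiableAt ℝ W₁ x :=
    ((Real.smoothTransition.contDiff.comp (contDiff_coneFn A 0 (n := 1))).differentiable
      (by simp)) x
  have hW₂d : DifferentiableAt ℝ W₂ x :=
    (Real.smoothTransition.contDiff.contDiffAt.comp x
      (((contDiffAt_horizonFn M hxpos (n := 1)).div_const ε).sub
        contDiffAt_const)).differentiableAt (by simp)
  -- the three fluxes
  have h1 : ∑ μ, fderiv ℝ W₁ x (E4.basisVector μ) * KerrSchild.normalCurrent B.inverseMetric w x μ
      ≤ 0 := coneFactor_flux B w 0 hxA
  have h2 : ∑ μ, fderiv ℝ W₂ x (E4.basisVector μ) * KerrSchild.normalCurrent B.inverseMetric w x μ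
      ≤ 0 := horizonFactor_flux hMa w hε hx
  have h0 : ∑ μ, fderiv ℝ U₀ x (E4.basisVector μ) * KerrSchild.normalCurrent B.inverseMetric w x μ
      ≤ 0 := by
    -- `dU₀ = −χ'(A − x⁰) dt`, flux `−χ'(A − x⁰) P⁰ ≤ 0`
    have hproj : HasFDerivAt (fun y : E4 ↦ y 0) (EuclideanSpace.proj (𝕜 := ℝ) (0 : Fin 4)) x :=
      (EuclideanSpace.proj (𝕜 := ℝ) (0 : Fin 4)).hasFDerivAt
    have hinner : HasFDerivAt (fun y : E4 ↦ A - y 0)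
        (-(EuclideanSpace.proj (𝕜 := ℝ) (0 : Fin 4))) x := hproj.const_sub A
    have houter : HasDerivAt Real.smoothTransition (deriv Real.smoothTransition (A - x 0))
        (A - x 0) :=
      ((Real.smoothTransition.contDiffAt (n := 1)).differentiableAt (by simp)).hasDerivAt
    have hd' := houter.comp_hasFDerivAt x hinner
    have hd : HasFDerivAt U₀ ((deriv Real.smoothTransition (A - x 0)) •
        (-(EuclideanSpace.proj (𝕜 := ℝ) (0 : Fin 4)))) x := hd'
    rw [hd.fderiv]
    have hχ' : 0 ≤ deriv Real.smoothTransition (A - x 0) :=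
      Real.smoothTransition.monotone.deriv_nonneg
    have hP0 : 0 ≤ KerrSchild.normalCurrent B.inverseMetric w x 0 := B.normalCurrent_zero_nonneg w x
    have happ : ∀ v : E4, ((deriv Real.smoothTransition (A - x 0)) •
        (-(EuclideanSpace.proj (𝕜 := ℝ) (0 : Fin 4)))) v =
        -(deriv Real.smoothTransition (A - x 0) * v 0) := fun v ↦ by
      show deriv Real.smoothTransition (A - x 0) * (-(v 0)) = _
      ring
    have hb0 : (E4.basisVector 0 : E4) 0 = 1 := by simp [E4.basisVector]
    have hb1 : (E4.basisVector 1 : E4) 0 = 0 := by simp [E4.basisVector]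
    have hb2 : (E4.basisVector 2 : E4) 0 = 0 := by simp [E4.basisVector]
    have hb3 : (E4.basisVector 3 : E4) 0 = 0 := by simp [E4.basisVector]
    simp only [Fin.sum_univ_four, happ, hb0, hb1, hb2, hb3, mul_zero, neg_zero, zero_mul,
      add_zero, mul_one]
    nlinarith
  have hU₀0 : 0 ≤ U₀ x := Real.smoothTransition.nonneg _
  have hW₁0 : 0 ≤ W₁ x := Real.smoothTransition.nonneg _
  have hW₂0 : 0 ≤ W₂ x := Real.smoothTransition.nonneg _
  have hUW : DifferentiableAt ℝ (fun y ↦ U₀ y * W₁ y) x := hU₀d.mul hW₁d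
  rw [hWfun, fderiv_fun_mul hUW hW₂d, fderiv_fun_mul hU₀d hW₁d]
  simp only [add_apply, FunLike.coe_smul, Pi.smul_apply, smul_eq_mul]
  have hexp : ∀ μ, ((U₀ x * W₁ x) * fderiv ℝ W₂ x (E4.basisVector μ) +
      W₂ x * (U₀ x * fderiv ℝ W₁ x (E4.basisVector μ) + W₁ x * fderiv ℝ U₀ x (E4.basisVector μ))) *
        KerrSchild.normalCurrent B.inverseMetric w x μ =
      (U₀ x * W₁ x) * (fderiv ℝ W₂ x (E4.basisVector μ) *
          KerrSchild.normalCurrent B.inverseMetric w x μ) +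
        (W₂ x * U₀ x) * (fderiv ℝ W₁ x (E4.basisVector μ) *
          KerrSchild.normalCurrent B.inverseMetric w x μ) +
        (W₂ x * W₁ x) * (fderiv ℝ U₀ x (E4.basisVector μ) *
          KerrSchild.normalCurrent B.inverseMetric w x μ) := fun μ ↦ by ring
  simp only [hexp, Finset.sum_add_distrib, ← Finset.mul_sum]
  have t1 := mul_nonpos_iff.mpr (Or.inl ⟨mul_nonneg hU₀0 hW₁0, h2⟩)
  have t2 := mul_nonpos_iff.mpr (Or.inl ⟨mul_nonneg hW₂0 hU₀0, h1⟩)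
  have t3 := mul_nonpos_iff.mpr (Or.inl ⟨mul_nonneg hW₂0 hW₁0, h0⟩)
  linarith

end Kerr

/-! ### The weighted energy inequality along the translates of a uniformly spacelike graph -/

namespace KerrSchild.Background

/-- **The weighted energy inequality along a graph foliation (Hawking–Ellis in weighted form,
graph leaves).** Let `B` be a generalised Kerr–Schild background, `Φ` of class `C²` at the points
of `U ⊆ ℝ⁴`, `K ⊆ U` closed, `W ≥ 0` a `C¹` weight with `{W ≠ 0} ⊆ K` and `□_G Φ = 0` on `K`;
let `F` be a `C²` height function with `|∇F|² ≤ (1 − c)²`, `0 < c ≤ 1` (the graphs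
`Σ_t = {x⁰ = t + F(x⃗)}` are uniformly spacelike: `Kerr.IsAdmissibleHeight`). Assume, on the slab
`{F(x⃗) ≤ x⁰ ≤ T + F(x⃗)} ∩ K` between `Σ_0` and `Σ_T`, the **flux condition**
`∑_μ (∂_μW) P^μ ≤ 0` and the spatial bound `‖x⃗‖ ≤ ρ`, and `|∂g^{αβ}| ≤ D` on `K`. Then the
weighted energy through the leaves, `E_W(t) = ∫ W · ∑_μ n_μ P^μ (t + F(y), y) dy` (`n = dt − dF`;
a nonnegative density by the dominant energy condition), satisfies
`E_W(s) ≤ E_W(0) e^{C s}` for `0 ≤ s ≤ T`, `C = 192 (1 + Φ_B) D / c`.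
Proof: the divergence identity between the graphs of `F` and `s + F`
(`E4.graphFlux_sub_eq_integral_divergence`, with `∑ ∂_μ(W P^μ) = ∑(∂W)P + W R` on `K`), the
pointwise bound `∑(∂W)P + W R ≤ 192(1 + Φ)D · W P⁰ ≤ C · W ∑ n_μ P^μ`
(`abs_deformationTerm_le`, `sum_sq_le_six_mul_normalCurrent_zero`,
`mul_normalCurrent_zero_le_graphFlux`), the substitution `u = θ s` and Grönwall's inequality — the
argument of `weightedEnergy_le` for the leaves `{t = const}`. Hawking–Ellis 1973, §4.3, Lemma 4.3.1;
Dafermos–Rodnianski–Shlapentokh-Rothman arXiv:1402.7034, §2.3.2 (the divergence identity between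
`Σ̃_τ = φ_τ(Σ̃₀)`), §13.1.1 ("finite in time energy estimates").
[cite: HawkingEllis1973CUP, §4.3 Lemma 4.3.1; DafermosRodnianskiShlapentokhrothman2014, §2.3.2] -/
theorem graphWeightedEnergy_le (B : Background) {U K : Set E4} (hKc : IsClosed K) (hKU : K ⊆ U)
    {Φ W : E4 → ℝ} (hΦ : ∀ x ∈ U, ContDiffAt ℝ 2 Φ x) (hW : ContDiff ℝ 1 W)
    (hW0 : ∀ x, 0 ≤ W x) (hWK : ∀ x, W x ≠ 0 → x ∈ K)
    (hsol : ∀ x ∈ K, waveOperator B.inverseMetric Φ x = 0)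
    {F : E3 → ℝ} (hF : ContDiff ℝ 2 F) {c : ℝ} (hc : 0 < c) (hc1 : c ≤ 1)
    (hFc : ∀ y, ∑ i, Kerr.partialE3 F y i ^ 2 ≤ (1 - c) ^ 2) {T : ℝ}
    (hflux : ∀ x ∈ K, F (E4.spatial x) ≤ x 0 → x 0 ≤ T + F (E4.spatial x) →
      ∑ μ, fderiv ℝ W x (E4.basisVector μ) * normalCurrent B.inverseMetric Φ x μ ≤ 0)
    {ρ D : ℝ}
    (hρ : ∀ x ∈ K, F (E4.spatial x) ≤ x 0 → x 0 ≤ T + F (E4.spatial x) → E4.spatialNorm x ≤ ρ)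
    (hD0 : 0 ≤ D)
    (hD : ∀ x ∈ K, ∀ μ α β, |fderiv ℝ (fun y ↦ B.inverseMetric y α β) x (E4.basisVector μ)| ≤ D)
    {s : ℝ} (hs0 : 0 ≤ s) (hsT : s ≤ T) :
    (∫ y in closedBall (0 : E3) ρ, W (E4.ofTimeSpace (s + F y) y) *
        ∑ μ, Kerr.graphConormal F y μ *
          normalCurrent B.inverseMetric Φ (E4.ofTimeSpace (s + F y) y) μ) ≤
      (∫ y in closedBall (0 : E3) ρ, W (E4.ofTimeSpace (0 + F y) y) *
        ∑ μ, Kerr.graphConormal F y μ *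
          normalCurrent B.inverseMetric Φ (E4.ofTimeSpace (0 + F y) y) μ) *
        Real.exp (192 * (1 + B.bound) * D / c * s) := by
  -- ### notation
  set G := B.inverseMetric with hG
  set Φb := B.bound with hΦb
  have hΦb0 : 0 ≤ Φb := (B.φ_nonneg 0).trans (B.φ_le 0)
  set P : Fin 4 → E4 → ℝ := fun μ x ↦ normalCurrent G Φ x μ with hP
  set J : Fin 4 → E4 → ℝ := fun μ x ↦ W x * P μ x with hJ
  set b : E4 → ℝ := fun x ↦ (∑ μ, fderiv ℝ W x (E4.basisVector μ) * P μ x) +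
    W x * deformationTerm G Φ x with hb
  set n : E4 → Fin 4 → ℝ := fun x μ ↦ Kerr.graphConormal F (E4.spatial x) μ with hn
  set q : E4 → ℝ := fun x ↦ W x * ∑ μ, n x μ * P μ x with hq
  -- ### regularity
  have hF1 : ContDiff ℝ 1 F := hF.of_le one_le_two
  have hP1 : ∀ μ, ∀ x ∈ U, ContDiffAt ℝ 1 (P μ) x := fun μ x hx ↦
    B.contDiffAt_normalCurrent (hΦ x hx) μ
  have hJ1 : ∀ μ, ContDiff ℝ 1 (J μ) := fun μ ↦
    contDiff_iff_contDiffAt.mpr fun x ↦ contDiffAt_weight_mul hKc hKU hW hWK (hP1 μ) x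
  have hWz : ∀ x, x ∉ K → W x = 0 := fun x hx ↦ by
    by_contra h; exact hx (hWK x h)
  have hdW0 : ∀ x, x ∉ K → fderiv ℝ W x = 0 := fun x hx ↦ fderiv_eq_zero_of_notMem hKc hWK hx
  have hJ0 : ∀ μ x, x ∉ K → J μ x = 0 := fun μ x hx ↦ by
    simp only [hJ, hWz x hx, zero_mul]
  have hdJ0 : ∀ μ x, x ∉ K → fderiv ℝ (J μ) x = 0 := fun μ x hx ↦
    fderiv_eq_zero_of_forall_mem_eq_zero hKc.isOpen_compl (fun y hy ↦ hJ0 μ y hy) hx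
  have hbz : ∀ x, x ∉ K → b x = 0 := fun x hx ↦ by
    simp only [hb, hdW0 x hx, hWz x hx, zero_apply, zero_mul, Finset.sum_const_zero, add_zero]
  have hqz : ∀ x, x ∉ K → q x = 0 := fun x hx ↦ by simp only [hq, hWz x hx, zero_mul]
  -- continuity of the conormal, of `b` and of `q` on `E4`
  have hnc : ∀ μ, Continuous fun x ↦ n x μ := by
    intro μ
    refine Fin.cases ?_ (fun i ↦ ?_) μ
    · simp only [hn, Kerr.graphConormal_zero]; exact continuous_const
    · simp only [hn, Kerr.graphConormal_succ, Kerr.partialE3]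
      exact (((hF1.continuous_fderiv one_ne_zero).comp E4.spatial.continuous).clm_apply
        continuous_const).neg
  have hbc : Continuous b := by
    have h1 : ∀ μ, Continuous fun x ↦ fderiv ℝ W x (E4.basisVector μ) * P μ x := fun μ ↦
      continuous_iff_continuousAt.mpr fun x ↦ continuousAt_weight_mul hKc hKU
        ((hW.continuous_fderiv one_ne_zero).clm_apply continuous_const)
        (fun y hy ↦ by rw [hdW0 y hy]; rfl) (fun y hy ↦ (hP1 μ y hy).continuousAt) x
    have h2 : Continuous fun x ↦ W x * deformationTerm G Φ x :=
      continuous_iff_continuousAt.mpr fun x ↦ continuousAt_weight_mul hKc hKU hW.continuous hWz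
        (fun y hy ↦ (B.contDiffAt_deformationTerm (hΦ y hy)).continuousAt) x
    exact (continuous_finsetSum _ fun μ _ ↦ h1 μ).add h2
  have hqc : Continuous q := by
    refine continuous_iff_continuousAt.mpr fun x ↦ continuousAt_weight_mul hKc hKU hW.continuous
      hWz (fun y hy ↦ ?_) x
    exact tendsto_finsetSum _ fun μ _ ↦ (hnc μ).continuousAt.mul (hP1 μ y hy).continuousAt
  -- ### the divergence of the weighted current: `∑ ∂_μ J^μ = b` everywhere
  have hdivJ : ∀ x, ∑ μ, fderiv ℝ (J μ) x (E4.basisVector μ) = b x := by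
    intro x
    by_cases hxK : x ∈ K
    · have hxU : x ∈ U := hKU hxK
      have hPd : ∀ μ, DifferentiableAt ℝ (P μ) x := fun μ ↦
        (hP1 μ x hxU).differentiableAt one_ne_zero
      have hWd : DifferentiableAt ℝ W x := (hW.differentiable one_ne_zero) x
      have hprod : ∀ μ κ, fderiv ℝ (J μ) x (E4.basisVector κ) =
          fderiv ℝ W x (E4.basisVector κ) * P μ x + W x * fderiv ℝ (P μ) x (E4.basisVector κ) := by
        intro μ κ
        have : J μ = fun y ↦ W y * P μ y := rfl
        rw [this, fderiv_fun_mul hWd (hPd μ)]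
        simp only [add_apply, FunLike.coe_smul, Pi.smul_apply, smul_eq_mul]
        ring
      have hsum : ∑ μ, fderiv ℝ (J μ) x (E4.basisVector μ) =
          (∑ μ, fderiv ℝ W x (E4.basisVector μ) * P μ x) +
            W x * ∑ μ, fderiv ℝ (P μ) x (E4.basisVector μ) := by
        simp only [hprod, Finset.sum_add_distrib, Finset.mul_sum]
      have hdivP := sum_fderiv_normalCurrent (B.differentiableAt_inverseMetric x)
        (B.inverseMetric_symm x) (hΦ x hxU)
      have hdivP' : ∑ μ, fderiv ℝ (P μ) x (E4.basisVector μ) = deformationTerm G Φ x := by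
        have h := hdivP
        rw [hsol x hxK, zero_mul, zero_add] at h
        exact h
      rw [hsum, hdivP']
    · rw [hbz x hxK]
      simp only [hdJ0 _ x hxK, zero_apply, Finset.sum_const_zero]
  -- ### positivity and the pointwise bound on the slab
  set C : ℝ := 192 * (1 + Φb) * D / c with hC
  have hC0 : 0 ≤ C := by positivity
  have hflux0 : ∀ x, 0 ≤ ∑ μ, n x μ * P μ x := by
    intro x
    have h := B.mul_normalCurrent_zero_le_graphFlux Φ x hc hc1 (hFc (E4.spatial x))
    have hP0 : 0 ≤ P 0 x := B.normalCurrent_zero_nonneg Φ x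
    exact le_trans (mul_nonneg hc.le hP0) h
  have hq0 : ∀ x, 0 ≤ q x := fun x ↦ mul_nonneg (hW0 x) (hflux0 x)
  have hpt : ∀ x : E4, F (E4.spatial x) ≤ x 0 → x 0 ≤ T + F (E4.spatial x) → b x ≤ C * q x := by
    intro x hx0 hxT
    by_cases hxK : x ∈ K
    · have hfl := hflux x hxK hx0 hxT
      have hR := B.abs_deformationTerm_le Φ x hD0 (hD x hxK)
      have hcoer := B.sum_sq_le_six_mul_normalCurrent_zero Φ x
      have hgr := B.mul_normalCurrent_zero_le_graphFlux Φ x hc hc1 (hFc (E4.spatial x))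
      have hWx := hW0 x
      have h3 : deformationTerm G Φ x ≤ 192 * (1 + Φb) * D * normalCurrent G Φ x 0 := by
        have := le_abs_self (deformationTerm G Φ x)
        have h4 : 32 * (1 + Φb) * D * ∑ μ, fderiv ℝ Φ x (E4.basisVector μ) ^ 2 ≤
            32 * (1 + Φb) * D * (6 * normalCurrent G Φ x 0) :=
          mul_le_mul_of_nonneg_left hcoer (by positivity)
        linarith
      -- `P⁰ ≤ (∑ n_μ P^μ)/c`
      have h6 : normalCurrent G Φ x 0 ≤ (∑ μ, n x μ * P μ x) / c := by
        rw [le_div_iff₀ hc, mul_comm]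
        exact hgr
      have h5 : W x * deformationTerm G Φ x ≤ W x * (192 * (1 + Φb) * D *
          ((∑ μ, n x μ * P μ x) / c)) :=
        mul_le_mul_of_nonneg_left (h3.trans (mul_le_mul_of_nonneg_left h6 (by positivity))) hWx
      calc b x = (∑ μ, fderiv ℝ W x (E4.basisVector μ) * P μ x) +
            W x * deformationTerm G Φ x := rfl
        _ ≤ 0 + W x * (192 * (1 + Φb) * D * ((∑ μ, n x μ * P μ x) / c)) := add_le_add hfl h5
        _ = C * q x := by rw [hC, hq]; field_simp; ring
    · rw [hbz x hxK, hqz x hxK, mul_zero]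
  -- ### vanishing beyond the spatial radius `ρ` on the slab
  have hfar : ∀ x : E4, ρ < E4.spatialNorm x → F (E4.spatial x) ≤ x 0 →
      x 0 ≤ T + F (E4.spatial x) → x ∉ K := by
    intro x hxρ hx0 hxT hxK
    exact absurd (hρ x hxK hx0 hxT) (not_le.mpr hxρ)
  -- points of the graphs of `t + F`, `0 ≤ t ≤ T`, lie in the slab
  have hslab : ∀ (t : ℝ) (y : E3), 0 ≤ t → t ≤ T →
      F (E4.spatial (E4.ofTimeSpace (t + F y) y)) ≤ (E4.ofTimeSpace (t + F y) y) 0 ∧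
        (E4.ofTimeSpace (t + F y) y) 0 ≤ T + F (E4.spatial (E4.ofTimeSpace (t + F y) y)) := by
    intro t y ht0 htT
    simp only [E4.spatial_ofTimeSpace, E4.ofTimeSpace_apply_zero]
    exact ⟨by linarith, by linarith⟩
  have hout : ∀ (h : E4 → ℝ), (∀ x, x ∉ K → h x = 0) → ∀ (t : ℝ) (y : E3), 0 ≤ t → t ≤ T →
      y ∉ closedBall (0 : E3) ρ → h (E4.ofTimeSpace (t + F y) y) = 0 := by
    intro h hh t y ht0 htT hy
    refine hh _ (hfar _ ?_ (hslab t y ht0 htT).1 (hslab t y ht0 htT).2)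
    rw [mem_closedBall, dist_zero_right, not_le] at hy
    rwa [E4.spatialNorm_ofTimeSpace]
  -- ### the slice functions along the graph foliation
  set f : ℝ → ℝ := fun t ↦ ∫ y in closedBall (0 : E3) ρ, q (E4.ofTimeSpace (t + F y) y) with hf
  set g : ℝ → ℝ := fun t ↦ ∫ y in closedBall (0 : E3) ρ, b (E4.ofTimeSpace (t + F y) y) with hg
  have hgraphc : Continuous fun p : ℝ × E3 ↦ E4.ofTimeSpace (p.1 + F p.2) p.2 :=
    E4.continuous_ofTimeSpace' (continuous_fst.add (hF.continuous.comp continuous_snd))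
      continuous_snd
  have hfc : Continuous f :=
    continuous_parametric_integral_of_continuous (f := fun (t : ℝ) (y : E3) ↦
      q (E4.ofTimeSpace (t + F y) y)) (hqc.comp hgraphc) (isCompact_closedBall _ _)
  have hgc : Continuous g :=
    continuous_parametric_integral_of_continuous (f := fun (t : ℝ) (y : E3) ↦
      b (E4.ofTimeSpace (t + F y) y)) (hbc.comp hgraphc) (isCompact_closedBall _ _)
  have hf0 : ∀ t, 0 ≤ f t := fun t ↦
    setIntegral_nonneg measurableSet_closedBall fun y _ ↦ hq0 _
  -- the statement is about `f s` and `f 0`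
  have hfq : ∀ t, (∫ y in closedBall (0 : E3) ρ, W (E4.ofTimeSpace (t + F y) y) *
      ∑ μ, Kerr.graphConormal F y μ * normalCurrent B.inverseMetric Φ (E4.ofTimeSpace (t + F y) y) μ)
      = f t := by
    intro t
    simp only [hf, hq, hn, hP, E4.spatial_ofTimeSpace, hG]
  rw [hfq s, hfq 0]
  -- ### the divergence identity between the graphs of `F` and `t + F`, `0 ≤ t ≤ T`
  have hfluxq : ∀ (t' : ℝ) (y : E3), ∑ μ, J μ (E4.ofTimeSpace (t' + F y) y) *
      Kerr.graphConormal F y μ = q (E4.ofTimeSpace (t' + F y) y) := by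
    intro t' y
    simp only [hJ, hq, hn, E4.spatial_ofTimeSpace, Finset.mul_sum]
    exact Finset.sum_congr rfl fun μ _ ↦ by ring
  have hE3f : ∀ t', 0 ≤ t' → t' ≤ T → (∫ y, q (E4.ofTimeSpace (t' + F y) y)) = f t' := by
    intro t' h0 h1
    rw [hf]
    exact (setIntegral_eq_integral_of_forall_compl_eq_zero
      (fun y hy ↦ hout q hqz t' y h0 h1 hy)).symm
  have hE3g : ∀ t', 0 ≤ t' → t' ≤ T → (∫ y, b (E4.ofTimeSpace (t' + F y) y)) = g t' := by
    intro t' h0 h1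
    rw [hg]
    exact (setIntegral_eq_integral_of_forall_compl_eq_zero
      (fun y hy ↦ hout b hbz t' y h0 h1 hy)).symm
  have hident : ∀ t, 0 ≤ t → t ≤ T → f t - f 0 = ∫ θ in Set.Ioc (0 : ℝ) 1, t * g (θ * t) := by
    intro t ht0 htT
    have hF₂ : ContDiff ℝ 2 (fun y ↦ t + F y) := contDiff_const.add hF
    have hle : ∀ y, F y ≤ t + F y := fun y ↦ by linarith
    have hJ0' : ∀ μ (x : E4), ρ < E4.spatialNorm x → 0 + F (E4.spatial x) ≤ x 0 →
        x 0 ≤ 0 + (t + F (E4.spatial x)) → J μ x = 0 := fun μ x hxρ h1 h2 ↦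
      hJ0 μ x (hfar x hxρ (by linarith) (by linarith))
    have hid := E4.graphFlux_sub_eq_integral_divergence hJ1 hF hF₂ hle (τ := 0) (ρ := ρ) hJ0'
    have hncong : ∀ (y : E3) (μ : Fin 4),
        Kerr.graphConormal (fun y ↦ t + F y) y μ = Kerr.graphConormal F y μ := by
      intro y μ
      refine Fin.cases rfl (fun i ↦ ?_) μ
      simp only [Kerr.graphConormal_succ, Kerr.partialE3, fderiv_const_add]
    have hL1 : (∫ y, ∑ μ, J μ (E4.ofTimeSpace (0 + (t + F y)) y) *
        Kerr.graphConormal (fun y ↦ t + F y) y μ) = f t := by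
      simp only [zero_add, hncong, hfluxq]
      exact hE3f t ht0 htT
    have hL2 : (∫ y, ∑ μ, J μ (E4.ofTimeSpace (0 + F y) y) * Kerr.graphConormal F y μ) = f 0 := by
      simp only [hfluxq]
      exact hE3f 0 le_rfl (ht0.trans htT)
    have hR : (∫ θ in Set.Ioc (0 : ℝ) 1, ∫ y, ((t + F y) - F y) *
        ∑ μ, fderiv ℝ (J μ) (E4.ofTimeSpace (0 + (F y + θ * ((t + F y) - F y))) y)
          (E4.basisVector μ)) = ∫ θ in Set.Ioc (0 : ℝ) 1, t * g (θ * t) := by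
      refine setIntegral_congr_fun measurableSet_Ioc fun θ hθ ↦ ?_
      have hθt0 : 0 ≤ θ * t := mul_nonneg hθ.1.le ht0
      have hθtT : θ * t ≤ T := (mul_le_of_le_one_left ht0 hθ.2).trans htT
      simp only [add_sub_cancel_right, zero_add, hdivJ]
      rw [MeasureTheory.integral_const_mul]
      congr 1
      have : ∀ y, E4.ofTimeSpace (F y + θ * t) y = E4.ofTimeSpace (θ * t + F y) y := fun y ↦ by
        rw [add_comm]
      simp only [this]
      exact hE3g (θ * t) hθt0 hθtT
    rw [← hL1, ← hL2, ← hR]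
    exact hid
  -- ### the substitution `u = θ t`
  have hsub : ∀ t, 0 ≤ t → ∫ θ in Set.Ioc (0 : ℝ) 1, t * g (θ * t) = ∫ u in Set.Ioc 0 t, g u := by
    intro t ht0
    have h := intervalIntegral.smul_integral_comp_mul_right (f := g) (a := 0) (b := 1) t
    rw [smul_eq_mul, zero_mul, one_mul] at h
    rw [← intervalIntegral.integral_of_le zero_le_one, ← intervalIntegral.integral_of_le ht0,
      intervalIntegral.integral_const_mul, h]
  -- ### the integral inequality `f t ≤ f 0 + ∫_0^t C f` on `[0, T]`
  have hineq : ∀ t, 0 ≤ t → t ≤ T → f t ≤ f 0 + ∫ u in Set.Ioc 0 t, C * f u := by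
    intro t ht0 htT
    have hid' : f t - f 0 = ∫ u in Set.Ioc 0 t, g u := by rw [hident t ht0 htT, hsub t ht0]
    have hmono : ∫ u in Set.Ioc 0 t, g u ≤ ∫ u in Set.Ioc 0 t, C * f u := by
      refine setIntegral_mono_on (hgc.integrableOn_Icc.mono_set Set.Ioc_subset_Icc_self)
        ((continuous_const.mul hfc).integrableOn_Icc.mono_set Set.Ioc_subset_Icc_self)
        measurableSet_Ioc fun u hu ↦ ?_
      have hu0 : 0 ≤ u := hu.1.le
      have huT : u ≤ T := hu.2.trans htT
      have hgraphu : Continuous fun y : E3 ↦ E4.ofTimeSpace (u + F y) y :=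
        E4.continuous_ofTimeSpace' (continuous_const.add hF.continuous) continuous_id
      have hi1 : IntegrableOn (fun y : E3 ↦ b (E4.ofTimeSpace (u + F y) y))
          (closedBall (0 : E3) ρ) :=
        (hbc.comp hgraphu).continuousOn.integrableOn_compact (isCompact_closedBall _ _)
      have hi2 : IntegrableOn (fun y : E3 ↦ C * q (E4.ofTimeSpace (u + F y) y))
          (closedBall (0 : E3) ρ) :=
        (continuous_const.mul (hqc.comp hgraphu)).continuousOn.integrableOn_compact
          (isCompact_closedBall _ _)
      calc g u ≤ ∫ y in closedBall (0 : E3) ρ, C * q (E4.ofTimeSpace (u + F y) y) :=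
            setIntegral_mono_on hi1 hi2 measurableSet_closedBall fun y _ ↦
              hpt _ (hslab u y hu0 huT).1 (hslab u y hu0 huT).2
        _ = C * f u := by
            rw [hf, ← MeasureTheory.integral_const_mul]
    linarith
  -- ### Grönwall, applied to the primitive `∫_0^u f`
  have hT : 0 ≤ T := hs0.trans hsT
  by_cases hCz : C = 0
  · have h := hineq s hs0 hsT
    simp only [hCz, zero_mul, integral_zero, add_zero] at h
    rw [hCz, zero_mul, Real.exp_zero, mul_one]
    exact h
  have hCpos : 0 < C := lt_of_le_of_ne hC0 (Ne.symm hCz)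
  set A : ℝ := f 0 with hA
  have hA0 : 0 ≤ A := hf0 0
  have hineq' : ∀ t, 0 ≤ t → t ≤ T → f t ≤ A + C * ∫ u in (0 : ℝ)..t, f u := by
    intro t h0 h1
    have h := hineq t h0 h1
    rw [MeasureTheory.integral_const_mul] at h
    rw [intervalIntegral.integral_of_le h0]
    exact h
  set Fp : ℝ → ℝ := fun u ↦ ∫ t in (0 : ℝ)..u, f t with hFp
  have hFderiv : ∀ u, HasDerivAt Fp (f u) u := fun u ↦
    intervalIntegral.integral_hasDerivAt_right (hfc.intervalIntegrable _ _)
      (hfc.stronglyMeasurableAtFilter _ _) hfc.continuousAt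
  have hFcont : Continuous Fp := continuous_iff_continuousAt.mpr fun u ↦ (hFderiv u).continuousAt
  have hFp0 : ∀ u, 0 ≤ u → 0 ≤ Fp u := fun u hu ↦ by
    rw [hFp]
    exact intervalIntegral.integral_nonneg_of_forall hu fun t ↦ hf0 t
  have hgron := norm_le_gronwallBound_of_norm_deriv_right_le (f := Fp) (f' := f) (δ := 0) (K := C)
    (ε := A) (a := 0) (b := T) hFcont.continuousOn (fun u _ ↦ (hFderiv u).hasDerivWithinAt)
    (by simp [hFp]) (fun u hu ↦ by
      rw [Real.norm_of_nonneg (hf0 u), Real.norm_of_nonneg (hFp0 u hu.1)]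
      linarith [hineq' u hu.1 hu.2.le])
  have hFs : Fp s ≤ A / C * (Real.exp (C * s) - 1) := by
    have h := hgron s ⟨hs0, hsT⟩
    rw [Real.norm_of_nonneg (hFp0 s hs0), gronwallBound_of_K_ne_0 hCpos.ne', sub_zero] at h
    simpa using h
  have h1 := hineq' s hs0 hsT
  have h2 : C * Fp s ≤ A * (Real.exp (C * s) - 1) := by
    have := mul_le_mul_of_nonneg_left hFs hCpos.le
    rwa [← mul_assoc, mul_div_cancel₀ _ hCpos.ne'] at this
  nlinarith

end KerrSchild.Background

/-! ### Slope bookkeeping for height functions -/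

namespace Kerr

/-- `∑_i (∂_iF)² ≤ ‖dF‖²` (the components of the gradient in an orthonormal frame are bounded by
the operator norm: `dF(w) = ∑ (∂_iF)²` for `w = ∑ (∂_iF) e_i`, `‖w‖² = ∑ (∂_iF)²`). [folklore] -/
theorem sum_sq_partialE3_le (F : E3 → ℝ) (y : E3) :
    ∑ i, partialE3 F y i ^ 2 ≤ ‖fderiv ℝ F y‖ ^ 2 := by
  set L := fderiv ℝ F y with hL
  set w : E3 := ∑ i, partialE3 F y i • EuclideanSpace.single i (1 : ℝ) with hw
  set S : ℝ := ∑ i, partialE3 F y i ^ 2 with hS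
  have hwi : ∀ i, w i = partialE3 F y i := by
    intro i
    simp [hw, Finset.sum_apply, Pi.single_apply]
  have hnorm : ‖w‖ ^ 2 = S := by
    rw [EuclideanSpace.norm_sq_eq]
    exact Finset.sum_congr rfl fun i _ ↦ by rw [hwi, Real.norm_eq_abs, sq_abs]
  have hLw : L w = S := by
    simp only [hw, map_sum, map_smul, smul_eq_mul, hS, partialE3, hL]
    exact Finset.sum_congr rfl fun i _ ↦ by ring
  have hle : S ≤ ‖L‖ * ‖w‖ := by
    rw [← hLw]
    exact (le_abs_self _).trans (by simpa [Real.norm_eq_abs] using L.le_opNorm w)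
  have hw0 : 0 ≤ ‖w‖ := norm_nonneg _
  have hL0 : 0 ≤ ‖L‖ := norm_nonneg _
  by_cases hS0 : ‖w‖ = 0
  · rw [← hnorm, hS0, zero_pow two_ne_zero]; positivity
  · have hpos : 0 < ‖w‖ := lt_of_le_of_ne hw0 (Ne.symm hS0)
    have h1 : ‖w‖ * ‖w‖ ≤ ‖L‖ * ‖w‖ := by nlinarith
    have h2 : ‖w‖ ≤ ‖L‖ := le_of_mul_le_mul_right h1 hpos
    rw [← hnorm]
    exact pow_le_pow_left₀ hw0 h2 2

/-- A height function with `‖dF‖ ≤ 1 − c` satisfies `F(0) − (1 − c)‖y‖ ≤ F(y)` (mean value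
inequality). [folklore] -/
theorem sub_mul_norm_le_of_norm_fderiv_le {F : E3 → ℝ} (hF : Differentiable ℝ F) {c : ℝ}
    (hslope : ∀ y, ‖fderiv ℝ F y‖ ≤ 1 - c) (y : E3) : F 0 - (1 - c) * ‖y‖ ≤ F y := by
  have h := Convex.norm_image_sub_le_of_norm_fderiv_le (fun x _ ↦ hF x) (fun x _ ↦ hslope x)
    convex_univ (mem_univ 0) (mem_univ y)
  rw [sub_zero, Real.norm_eq_abs] at h
  linarith [neg_abs_le (F y - F 0)]

/-- The same in the form `F(y) ≤ F(0) + (1 − c)‖y‖`. [folklore] -/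
theorem le_add_mul_norm_of_norm_fderiv_le {F : E3 → ℝ} (hF : Differentiable ℝ F) {c : ℝ}
    (hslope : ∀ y, ‖fderiv ℝ F y‖ ≤ 1 - c) (y : E3) : F y ≤ F 0 + (1 - c) * ‖y‖ := by
  have h := Convex.norm_image_sub_le_of_norm_fderiv_le (fun x _ ↦ hF x) (fun x _ ↦ hslope x)
    convex_univ (mem_univ 0) (mem_univ y)
  rw [sub_zero, Real.norm_eq_abs] at h
  linarith [le_abs_self (F y - F 0)]

/-- The coordinate energy density along a graph, `y ↦ ∑_μ (∂_μΦ)²(t + F(y), y)`, is measurable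
(for continuous `F`). [folklore] -/
theorem measurable_sum_sq_fderiv_graph (Φ : E4 → ℝ) {F : E3 → ℝ} (hF : Continuous F) (t : ℝ) :
    Measurable fun y : E3 ↦
      ENNReal.ofReal (∑ μ, fderiv ℝ Φ (E4.ofTimeSpace (t + F y) y) (E4.basisVector μ) ^ 2) := by
  have hg : Continuous fun y : E3 ↦ E4.ofTimeSpace (t + F y) y :=
    E4.continuous_ofTimeSpace' (continuous_const.add hF) continuous_id
  refine ENNReal.measurable_ofReal.comp (Finset.measurable_sum _ fun μ _ ↦ ?_)
  exact ((measurable_fderiv_apply_const ℝ Φ (E4.basisVector μ)).comp hg.measurable).pow_const 2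

/-- **At graph-time `τ` the graph weight `graphWeight M a A ε` is `1` at `(τ + F(y), y)` for
`‖y‖ ≤ R`, `(r − r₊)e^{−(τ + F(y))/(2M)} ≥ 2ε`**, provided `A ≥ τ + F(0) + 2R + 2` and `F` has slope
`≤ 1` (so `F(y) ≤ F(0) + R`). [folklore] -/
theorem graphWeight_eq_one {M a A ε τ R : ℝ} {F : E3 → ℝ} (hFub : ∀ y : E3, F y ≤ F 0 + ‖y‖)
    (hA : τ + F 0 + 2 * R + 2 ≤ A) {y : E3} (hy : ‖y‖ ≤ R)
    (hh : 2 * ε ≤ horizonFn M a (E4.ofTimeSpace (τ + F y) y)) (hε : 0 < ε) :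
    graphWeight M a A ε (E4.ofTimeSpace (τ + F y) y) = 1 := by
  have hn0 : 0 ≤ ‖y‖ := norm_nonneg y
  have hFy : F y ≤ F 0 + R := (hFub y).trans (by linarith)
  have h1 : Real.smoothTransition (A - (E4.ofTimeSpace (τ + F y) y) 0) = 1 := by
    rw [E4.ofTimeSpace_apply_zero]
    exact Real.smoothTransition.one_of_one_le (by linarith)
  have h2 : Real.smoothTransition (coneFn A 0 (E4.ofTimeSpace (τ + F y) y)) = 1 := by
    refine Real.smoothTransition.one_of_one_le ?_
    have hn : 0 ≤ ‖y‖ := norm_nonneg y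
    have hAy : ‖y‖ + 1 ≤ A - (τ + F y) := by linarith
    simp only [coneFn, E4.ofTimeSpace_apply_zero, E4.spatial_ofTimeSpace, sub_zero]
    nlinarith
  have h3 : Real.smoothTransition (horizonFn M a (E4.ofTimeSpace (τ + F y) y) / ε - 1) = 1 := by
    refine Real.smoothTransition.one_of_one_le ?_
    have : 2 ≤ horizonFn M a (E4.ofTimeSpace (τ + F y) y) / ε := by
      rw [le_div_iff₀ hε]; linarith
    linarith
  simp only [graphWeight, h1, h2, h3, mul_one]

/-! ### The finite-in-time estimate through the translates of a uniformly spacelike graph -/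

/-- **Finite-in-time energy estimate through the graph leaves `Σ̃_τ = {t* = τ + F(y)}` on the Kerr
exterior, up to `𝓗⁺` (coordinate form).** For subextremal `(M, a)` there are `C₀ > 0`, `C₁ ≥ 0`
(`C₀ = 144 (1 + 4M/r₊)²`, `C₁ = 192 (1 + 4M/r₊) D(M, a)`) such that for every `C²` height function
`F` with slope `‖dF‖ ≤ 1 − c`, `0 < c ≤ 1` (e.g. an admissible height, `Kerr.IsAdmissibleHeight`),
every `Φ : ℝ⁴ → ℝ` of class `C²` at the exterior points solving the Kerr wave equation there, and
every `τ ≥ 0`,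
`∫_{Σ̃_τ ∩ {r > r₊}} ∑_μ (∂_μΦ)² dy ≤ (C₀/c) e^{(C₁/c) τ} ∫_{Σ̃₀ ∩ {r > r₊}} ∑_μ (∂_μΦ)² dy`
in `[0, ∞]` — the inequality of the named fact
`DafermosRodnianskiShlapentokhRothman2016_energyBoundedness_horizonRegular` for the foliation
`Σ̃_τ = φ_τ(Σ̃₀)` with a constant allowed to grow exponentially in `τ` (the printed Theorem 3.1 (23),
§3.3 of arXiv:1402.7034 is the `τ`-independent bound). Proof: `graphWeightedEnergy_le` on the
surgered background with the weight `Kerr.graphWeight` (flux condition `Kerr.graphWeight_flux`,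
spatial bound from the slope of `F`, global `D`), the two-sided comparison of the graph flux with
`∑(∂Φ)²` (`mul_normalCurrent_zero_le_graphFlux`, `abs_graphFlux_le`) and exhaustion of the graph
leaf by monotone convergence as in `Kerr.exterior_coordEnergy_le_exp`. Hawking–Ellis 1973, §4.3,
Lemma 4.3.1; Dafermos–Rodnianski arXiv:1010.5132, Prop. 4.6.1 (the reduction to admissible
hypersurfaces by local energy estimates); arXiv:1402.7034, §3.3, §13.1.1.
[cite: HawkingEllis1973CUP, §4.3 Lemma 4.3.1; DafermosRodnianskiShlapentokhrothman2014, §3.3] -/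
theorem exterior_graphCoordEnergy_le_exp {M a : ℝ} (hMa : IsSubextremal M a) :
    ∃ C₀ C₁ : ℝ, 0 < C₀ ∧ 0 ≤ C₁ ∧ ∀ (F : E3 → ℝ) (c : ℝ), ContDiff ℝ 2 F → 0 < c → c ≤ 1 →
      (∀ y, ‖fderiv ℝ F y‖ ≤ 1 - c) →
      ∀ Φ : E4 → ℝ,
      (∀ x ∈ (exterior M a : Set E4), ContDiffAt ℝ 2 Φ x) →
      (∀ x ∈ (exterior M a : Set E4),
        KerrSchild.waveOperator
          (KerrSchild.inverseMetric (fun y ↦ 2 * scalarH M a y) (nullVector a)) Φ x = 0) →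
      ∀ τ : ℝ, 0 ≤ τ →
        (∫⁻ y, {y : E3 | E4.ofTimeSpace (τ + F y) y ∈ exterior M a}.indicator
            (fun y ↦ ENNReal.ofReal
              (∑ μ, fderiv ℝ Φ (E4.ofTimeSpace (τ + F y) y) (E4.basisVector μ) ^ 2)) y) ≤
          ENNReal.ofReal (C₀ / c * Real.exp (C₁ / c * τ)) *
            ∫⁻ y, {y : E3 | E4.ofTimeSpace (0 + F y) y ∈ exterior M a}.indicator
              (fun y ↦ ENNReal.ofReal
                (∑ μ, fderiv ℝ Φ (E4.ofTimeSpace (0 + F y) y) (E4.basisVector μ) ^ 2)) y := by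
  -- ### constants
  have hM : 0 < M := hMa.pos
  have hrp : 0 < rPlus M a := hMa.rPlus_pos
  set B := surgeryBackground M a (rPlus M a) hMa.pos.le hMa.rPlus_pos with hB
  obtain ⟨D, hD0, hD⟩ :=
    exists_bound_fderiv_surgeryBackground_inverseMetric hMa.pos.le a hMa.rPlus_pos
  have hΦb0 : 0 ≤ B.bound := (B.φ_nonneg 0).trans (B.φ_le 0)
  refine ⟨144 * (1 + B.bound) ^ 2, 192 * (1 + B.bound) * D, by positivity, by positivity,
    fun F c hF hc hc1 hslope Φ hΦ2 hsol τ hτ ↦ ?_⟩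
  -- ### the equation on the surgered background
  have hsolB : ∀ x ∈ (exterior M a : Set E4),
      KerrSchild.waveOperator B.inverseMetric Φ x = 0 := by
    intro x hx
    rw [← KerrSchild.waveOperator_congr_of_eventuallyEq
      (surgeryBackground_inverseMetric_eventuallyEq M a hMa.pos.le hMa.rPlus_pos ⟨x, hx⟩) Φ]
    exact hsol x hx
  -- ### the slope of `F`
  have hFd : Differentiable ℝ F := hF.differentiable two_ne_zero
  have hF1 : ContDiff ℝ 1 F := hF.of_le one_le_two
  have hFcomp : ∀ y, ∑ i, partialE3 F y i ^ 2 ≤ (1 - c) ^ 2 := fun y ↦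
    (sum_sq_partialE3_le F y).trans (pow_le_pow_left₀ (norm_nonneg _) (hslope y) 2)
  have hFlip : ∀ y, F 0 - (1 - c) * ‖y‖ ≤ F y := sub_mul_norm_le_of_norm_fderiv_le hFd hslope
  have hFub : ∀ y, F y ≤ F 0 + ‖y‖ := fun y ↦
    (le_add_mul_norm_of_norm_fderiv_le hFd hslope y).trans (by nlinarith [norm_nonneg y, hc.le])
  have hdFi : ∀ y i, |partialE3 F y i| ≤ 1 := fun y i ↦
    (abs_partialE3_le F y i).trans ((hslope y).trans (by linarith [hc.le]))
  -- ### notation: densities and energies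
  set P0 : E4 → ℝ := fun x ↦ KerrSchild.normalCurrent B.inverseMetric Φ x 0 with hP0
  set Q : E4 → ℝ := fun x ↦ ∑ μ, graphConormal F (E4.spatial x) μ *
    KerrSchild.normalCurrent B.inverseMetric Φ x μ with hQ
  set fd : ℝ → E3 → ℝ≥0∞ := fun t y ↦
    ENNReal.ofReal (∑ μ, fderiv ℝ Φ (E4.ofTimeSpace (t + F y) y) (E4.basisVector μ) ^ 2) with hfd
  have hfm : ∀ t, Measurable (fd t) := fun t ↦ measurable_sum_sq_fderiv_graph Φ hF.continuous t
  set E0 : ℝ≥0∞ := ∫⁻ y, {y : E3 | E4.ofTimeSpace (0 + F y) y ∈ exterior M a}.indicator (fd 0) y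
    with hE0
  have hP0nn : ∀ x, 0 ≤ P0 x := fun x ↦ B.normalCurrent_zero_nonneg Φ x
  have hQlow : ∀ x, c * P0 x ≤ Q x := fun x ↦
    B.mul_normalCurrent_zero_le_graphFlux Φ x hc hc1 (hFcomp (E4.spatial x))
  have hQnn : ∀ x, 0 ≤ Q x := fun x ↦ (mul_nonneg hc.le (hP0nn x)).trans (hQlow x)
  have hQup : ∀ x, Q x ≤ 24 * (1 + B.bound) ^ 2 * ∑ μ, fderiv ℝ Φ x (E4.basisVector μ) ^ 2 :=
    fun x ↦ (le_abs_self _).trans (B.abs_graphFlux_le Φ x (hdFi (E4.spatial x)))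
  have hlowQ : ∀ x, ∑ μ, fderiv ℝ Φ x (E4.basisVector μ) ^ 2 ≤ 6 / c * Q x := by
    intro x
    have h1 := KerrSchild.Background.sum_sq_le_six_mul_normalCurrent_zero B Φ x
    have h2 : P0 x ≤ Q x / c := by rw [le_div_iff₀ hc, mul_comm]; exact hQlow x
    calc ∑ μ, fderiv ℝ Φ x (E4.basisVector μ) ^ 2 ≤ 6 * P0 x := h1
      _ ≤ 6 * (Q x / c) := by gcongr
      _ = 6 / c * Q x := by ring
  -- continuity of `Q` at the exterior points
  have hnc : ∀ μ, Continuous fun x ↦ graphConormal F (E4.spatial x) μ := by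
    intro μ
    refine Fin.cases ?_ (fun i ↦ ?_) μ
    · simp only [graphConormal_zero]; exact continuous_const
    · simp only [graphConormal_succ, partialE3]
      exact (((hF1.continuous_fderiv one_ne_zero).comp E4.spatial.continuous).clm_apply
        continuous_const).neg
  have hQc : ∀ x ∈ (exterior M a : Set E4), ContinuousAt Q x := fun x hx ↦
    tendsto_finsetSum _ fun μ _ ↦
      (hnc μ).continuousAt.mul (B.contDiffAt_normalCurrent (hΦ2 x hx) μ).continuousAt
  -- the graph maps
  have hgraph : ∀ t : ℝ, Continuous fun y : E3 ↦ E4.ofTimeSpace (t + F y) y := fun t ↦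
    E4.continuous_ofTimeSpace' (continuous_const.add hF.continuous) continuous_id
  -- ### Step 1: the estimate on `{‖y‖ ≤ R} ∩ {(r − r₊) e^{−(τ + F)/(2M)} ≥ 2ε}`
  have hcore : ∀ R ε : ℝ, 0 ≤ R → 0 < ε →
      ∫⁻ y in {y : E3 | ‖y‖ ≤ R ∧ 2 * ε ≤ horizonFn M a (E4.ofTimeSpace (τ + F y) y)}, fd τ y ≤
        ENNReal.ofReal (144 * (1 + B.bound) ^ 2 / c *
          Real.exp (192 * (1 + B.bound) * D / c * τ)) * E0 := by
    intro R ε hR hε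
    set A : ℝ := τ + F 0 + 2 * R + 2 with hA
    have hAle : τ + F 0 + 2 * R + 2 ≤ A := le_rfl
    set W : E4 → ℝ := graphWeight M a A ε with hW
    set K : Set E4 := graphWeightSet M a A ε with hK
    have hKc : IsClosed K := isClosed_graphWeightSet M a A ε
    have hKU : K ⊆ (exterior M a : Set E4) := graphWeightSet_subset_exterior hrp hε
    have hWK : ∀ z, W z ≠ 0 → z ∈ K := fun z hz ↦ mem_graphWeightSet_of_ne_zero hε hz
    have hW1 : ContDiff ℝ 1 W := contDiff_graphWeight A hrp hε
    have hW0 : ∀ z, 0 ≤ W z := graphWeight_nonneg M a A ε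
    have hWle : ∀ z, W z ≤ 1 := graphWeight_le_one M a A ε
    have hWz : ∀ z, z ∉ K → W z = 0 := fun z hz ↦ by
      by_contra h; exact hz (hWK z h)
    have hsolK : ∀ z ∈ K, KerrSchild.waveOperator B.inverseMetric Φ z = 0 := fun z hz ↦
      hsolB z (hKU hz)
    have hflux : ∀ z ∈ K, F (E4.spatial z) ≤ z 0 → z 0 ≤ τ + F (E4.spatial z) →
        ∑ μ, fderiv ℝ W z (E4.basisVector μ) * KerrSchild.normalCurrent B.inverseMetric Φ z μ
          ≤ 0 := fun z _ _ _ ↦ graphWeight_flux hMa Φ A hε z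
    set ρ : ℝ := (A - F 0) / c with hρdef
    have hρ : ∀ z ∈ K, F (E4.spatial z) ≤ z 0 → z 0 ≤ τ + F (E4.spatial z) →
        E4.spatialNorm z ≤ ρ := fun z hz h1 _ ↦
      spatialNorm_le_of_mem_graphWeightSet hz hc hFlip h1
    have hDK : ∀ z ∈ K, ∀ μ α β,
        |fderiv ℝ (fun y ↦ B.inverseMetric y α β) z (E4.basisVector μ)| ≤ D :=
      fun z _ μ α β ↦ hD z μ α β
    -- Grönwall along the graph foliation
    have hgron := B.graphWeightedEnergy_le hKc hKU hΦ2 hW1 hW0 hWK hsolK hF hc hc1 hFcomp hflux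
      hρ hD0 hDK hτ le_rfl
    -- the weighted flux densities are continuous, hence integrable on the ball
    set WQ : E4 → ℝ := fun x ↦ W x * Q x with hWQ
    have hWQc : Continuous WQ := continuous_iff_continuousAt.mpr fun x ↦
      continuousAt_weight_mul hKc hKU hW1.continuous hWz hQc x
    set J : ℝ → E3 → ℝ := fun t y ↦ W (E4.ofTimeSpace (t + F y) y) *
      ∑ μ, graphConormal F y μ *
        KerrSchild.normalCurrent B.inverseMetric Φ (E4.ofTimeSpace (t + F y) y) μ with hJ
    have hJWQ : ∀ t, J t = fun y ↦ WQ (E4.ofTimeSpace (t + F y) y) := by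
      intro t
      funext y
      simp only [hJ, hWQ, hQ, E4.spatial_ofTimeSpace]
    have hJc : ∀ t, Continuous (J t) := fun t ↦ by rw [hJWQ t]; exact hWQc.comp (hgraph t)
    have hJnn : ∀ t y, 0 ≤ J t y := fun t y ↦ by
      rw [hJWQ t]
      exact mul_nonneg (hW0 _) (hQnn _)
    have hJi : ∀ t, IntegrableOn (J t) (closedBall (0 : E3) ρ) := fun t ↦
      (hJc t).continuousOn.integrableOn_compact (isCompact_closedBall 0 ρ)
    have hI : ∀ t, ENNReal.ofReal (∫ y in closedBall (0 : E3) ρ, J t y) =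
        ∫⁻ y in closedBall (0 : E3) ρ, ENNReal.ofReal (J t y) := fun t ↦
      ofReal_integral_eq_lintegral_ofReal (hJi t) (ae_of_all _ (hJnn t))
    have hI0nn : 0 ≤ ∫ y in closedBall (0 : E3) ρ, J 0 y :=
      setIntegral_nonneg measurableSet_closedBall fun y _ ↦ hJnn 0 y
    -- the set and its properties
    set S : Set E3 := {y : E3 | ‖y‖ ≤ R ∧ 2 * ε ≤ horizonFn M a (E4.ofTimeSpace (τ + F y) y)}
      with hS
    have hhc : Continuous fun y : E3 ↦ horizonFn M a (E4.ofTimeSpace (τ + F y) y) := by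
      show Continuous fun y : E3 ↦ (radius a (E4.ofTimeSpace (τ + F y) y) - rPlus M a) *
        Real.exp (-((2 * M)⁻¹ * (τ + F y)))
      exact (((continuous_radius a).comp (hgraph τ)).sub continuous_const).mul
        (Real.continuous_exp.comp (continuous_const.mul (continuous_const.add hF.continuous)).neg)
    have hSm : MeasurableSet S :=
      ((isClosed_le continuous_norm continuous_const).inter
        (isClosed_le continuous_const hhc)).measurableSet
    have hSsub : S ⊆ closedBall (0 : E3) ρ := by
      intro y hy
      rw [mem_closedBall, dist_zero_right]
      have hy1 := hy.1
      have hn0 : 0 ≤ ‖y‖ := norm_nonneg y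
      rw [hρdef, hA, le_div_iff₀ hc]
      nlinarith
    -- (i) lower bound at graph-time `τ`
    have h1 : ∫⁻ y in S, fd τ y ≤ ENNReal.ofReal (6 / c * ∫ y in closedBall (0 : E3) ρ, J τ y) := by
      calc ∫⁻ y in S, fd τ y ≤ ∫⁻ y in S, ENNReal.ofReal (6 / c * J τ y) := by
            refine setLIntegral_mono' hSm fun y hy ↦ ENNReal.ofReal_le_ofReal ?_
            have hWy : W (E4.ofTimeSpace (τ + F y) y) = 1 :=
              graphWeight_eq_one hFub hAle hy.1 hy.2 hε
            have := hlowQ (E4.ofTimeSpace (τ + F y) y)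
            simp only [hJ, hWy, one_mul]
            simpa only [hQ, E4.spatial_ofTimeSpace] using this
        _ ≤ ∫⁻ y in closedBall (0 : E3) ρ, ENNReal.ofReal (6 / c * J τ y) :=
            lintegral_mono_set hSsub
        _ = ENNReal.ofReal (∫ y in closedBall (0 : E3) ρ, 6 / c * J τ y) :=
            (ofReal_integral_eq_lintegral_ofReal ((hJi τ).const_mul (6 / c))
              (ae_of_all _ fun y ↦ by positivity [hJnn τ y])).symm
        _ = ENNReal.ofReal (6 / c * ∫ y in closedBall (0 : E3) ρ, J τ y) := by
            rw [integral_const_mul]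
    -- (ii) upper bound at graph-time `0`
    have h2 : ENNReal.ofReal (∫ y in closedBall (0 : E3) ρ, J 0 y) ≤
        ENNReal.ofReal (24 * (1 + B.bound) ^ 2) * E0 := by
      rw [hI 0]
      calc ∫⁻ y in closedBall (0 : E3) ρ, ENNReal.ofReal (J 0 y)
          ≤ ∫⁻ y in closedBall (0 : E3) ρ,
              {y : E3 | E4.ofTimeSpace (0 + F y) y ∈ exterior M a}.indicator
                (fun y ↦ ENNReal.ofReal (24 * (1 + B.bound) ^ 2) * fd 0 y) y := by
            refine lintegral_mono fun y ↦ ?_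
            by_cases hWy : W (E4.ofTimeSpace (0 + F y) y) = 0
            · have hJ0 : J 0 y = 0 := by simp only [hJ, hWy, zero_mul]
              rw [hJ0, ENNReal.ofReal_zero]
              exact zero_le
            · have hmem : E4.ofTimeSpace (0 + F y) y ∈ exterior M a := hKU (hWK _ hWy)
              rw [indicator_of_mem (show y ∈ {y : E3 | E4.ofTimeSpace (0 + F y) y ∈ exterior M a}
                from hmem), hfd, ← ENNReal.ofReal_mul (by positivity)]
              refine ENNReal.ofReal_le_ofReal ?_
              have hWQ0 : J 0 y = W (E4.ofTimeSpace (0 + F y) y) * Q (E4.ofTimeSpace (0 + F y) y) := by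
                rw [hJWQ 0]
              rw [hWQ0]
              calc W (E4.ofTimeSpace (0 + F y) y) * Q (E4.ofTimeSpace (0 + F y) y)
                  ≤ 1 * Q (E4.ofTimeSpace (0 + F y) y) :=
                    mul_le_mul_of_nonneg_right (hWle _) (hQnn _)
                _ ≤ 24 * (1 + B.bound) ^ 2 *
                      ∑ μ, fderiv ℝ Φ (E4.ofTimeSpace (0 + F y) y) (E4.basisVector μ) ^ 2 := by
                    rw [one_mul]; exact hQup _
        _ ≤ ∫⁻ y, {y : E3 | E4.ofTimeSpace (0 + F y) y ∈ exterior M a}.indicator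
              (fun y ↦ ENNReal.ofReal (24 * (1 + B.bound) ^ 2) * fd 0 y) y :=
            setLIntegral_le_lintegral _ _
        _ = ENNReal.ofReal (24 * (1 + B.bound) ^ 2) * E0 := by
            rw [hE0, ← lintegral_const_mul' _ _ ENNReal.ofReal_ne_top]
            refine lintegral_congr fun y ↦ ?_
            by_cases hy : y ∈ {y : E3 | E4.ofTimeSpace (0 + F y) y ∈ exterior M a}
            · simp only [indicator_of_mem hy]
            · simp only [indicator_of_notMem hy, mul_zero]
    -- (iii) assemble with Grönwall
    have hexp0 : 0 ≤ Real.exp (192 * (1 + B.bound) * D / c * τ) := (Real.exp_pos _).le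
    have h6c : 0 ≤ 6 / c := by positivity
    calc ∫⁻ y in S, fd τ y
        ≤ ENNReal.ofReal (6 / c * ∫ y in closedBall (0 : E3) ρ, J τ y) := h1
      _ ≤ ENNReal.ofReal (6 / c * ((∫ y in closedBall (0 : E3) ρ, J 0 y) *
            Real.exp (192 * (1 + B.bound) * D / c * τ))) :=
          ENNReal.ofReal_le_ofReal (mul_le_mul_of_nonneg_left hgron h6c)
      _ = ENNReal.ofReal (6 / c * Real.exp (192 * (1 + B.bound) * D / c * τ)) *
            ENNReal.ofReal (∫ y in closedBall (0 : E3) ρ, J 0 y) := by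
          rw [← ENNReal.ofReal_mul (by positivity)]
          congr 1; ring
      _ ≤ ENNReal.ofReal (6 / c * Real.exp (192 * (1 + B.bound) * D / c * τ)) *
            (ENNReal.ofReal (24 * (1 + B.bound) ^ 2) * E0) := by gcongr
      _ = ENNReal.ofReal (144 * (1 + B.bound) ^ 2 / c *
            Real.exp (192 * (1 + B.bound) * D / c * τ)) * E0 := by
          rw [← mul_assoc, ← ENNReal.ofReal_mul (by positivity)]
          congr 2; ring
  -- ### Step 2: exhaust the graph leaf by `ε = 1/(n+1) → 0`, `R = n → ∞`
  set S : ℕ → Set E3 := fun n ↦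
    {y : E3 | ‖y‖ ≤ (n : ℝ) ∧ 2 * (1 / ((n : ℝ) + 1)) ≤ horizonFn M a (E4.ofTimeSpace (τ + F y) y)}
    with hS
  have hhc : Continuous fun y : E3 ↦ horizonFn M a (E4.ofTimeSpace (τ + F y) y) := by
    show Continuous fun y : E3 ↦ (radius a (E4.ofTimeSpace (τ + F y) y) - rPlus M a) *
      Real.exp (-((2 * M)⁻¹ * (τ + F y)))
    exact (((continuous_radius a).comp (hgraph τ)).sub continuous_const).mul
      (Real.continuous_exp.comp (continuous_const.mul (continuous_const.add hF.continuous)).neg)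
  have hSm : ∀ n, MeasurableSet (S n) := fun n ↦
    ((isClosed_le continuous_norm continuous_const).inter
      (isClosed_le continuous_const hhc)).measurableSet
  have hSmono : ∀ {n m : ℕ}, n ≤ m → S n ⊆ S m := by
    intro n m hnm y hy
    have hcast : (n : ℝ) ≤ m := Nat.cast_le.mpr hnm
    refine ⟨hy.1.trans hcast, le_trans ?_ hy.2⟩
    have h1 : (0 : ℝ) < (n : ℝ) + 1 := by positivity
    gcongr
  have hUnion : {y : E3 | E4.ofTimeSpace (τ + F y) y ∈ exterior M a} = ⋃ n, S n := by
    ext y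
    simp only [mem_setOf_eq, mem_iUnion]
    constructor
    · intro hy
      have hr : rPlus M a < radius a (E4.ofTimeSpace (τ + F y) y) := lt_radius_of_mem_region hy
      set h : ℝ := horizonFn M a (E4.ofTimeSpace (τ + F y) y) with hh
      have hpos : 0 < h := mul_pos (sub_pos.mpr hr) (Real.exp_pos _)
      obtain ⟨n, hn⟩ := exists_nat_ge (max ‖y‖ (2 / h))
      refine ⟨n, (le_max_left _ _).trans hn, ?_⟩
      have h2 : 2 / h ≤ n := (le_max_right _ _).trans hn
      have hn1 : (0 : ℝ) < (n : ℝ) + 1 := by positivity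
      rw [div_le_iff₀ hpos] at h2
      rw [← hh, mul_one_div, div_le_iff₀ hn1]
      nlinarith
    · rintro ⟨n, -, hy⟩
      have hpos : 0 < horizonFn M a (E4.ofTimeSpace (τ + F y) y) :=
        lt_of_lt_of_le (by positivity) hy
      rw [mem_exterior, max_eq_left hrp.le]
      exact rPlus_lt_radius_of_horizonFn_pos hpos
  have hind : ∀ y, {y : E3 | E4.ofTimeSpace (τ + F y) y ∈ exterior M a}.indicator (fd τ) y =
      ⨆ n, (S n).indicator (fd τ) y := fun y ↦ by
    rw [hUnion]; exact indicator_iUnion_apply rfl _ _ _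
  have hmonof : Monotone fun n ↦ (S n).indicator (fd τ) := fun n m hnm y ↦
    indicator_le_indicator_of_subset (hSmono hnm) (fun _ ↦ zero_le) y
  calc ∫⁻ y, {y : E3 | E4.ofTimeSpace (τ + F y) y ∈ exterior M a}.indicator (fd τ) y
      = ∫⁻ y, ⨆ n, (S n).indicator (fd τ) y := lintegral_congr hind
    _ = ⨆ n, ∫⁻ y, (S n).indicator (fd τ) y :=
        lintegral_iSup (fun n ↦ (hfm τ).indicator (hSm n)) hmonof
    _ = ⨆ n, ∫⁻ y in S n, fd τ y := by
        congr with n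
        exact lintegral_indicator (hSm n) _
    _ ≤ ENNReal.ofReal (144 * (1 + B.bound) ^ 2 / c *
          Real.exp (192 * (1 + B.bound) * D / c * τ)) * E0 :=
        iSup_le fun n ↦ hcore (n : ℝ) (1 / ((n : ℝ) + 1)) n.cast_nonneg (by positivity)

/-- An admissible height function has slope constant `c ≤ 1` (since `‖dF‖ ≥ 0`). [folklore] -/
theorem IsAdmissibleHeight.exists_slope_le' {M : ℝ} {F : E3 → ℝ} (h : IsAdmissibleHeight M F) :
    ∃ c : ℝ, 0 < c ∧ c ≤ 1 ∧ ∀ y : E3, ‖fderiv ℝ F y‖ ≤ 1 - c := by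
  obtain ⟨c, hc, hcs⟩ := h.exists_slope_le
  exact ⟨c, hc, by linarith [hcs 0, norm_nonneg (fderiv ℝ F 0)], hcs⟩

end Kerr

/-- **Finite-in-time energy boundedness through the admissible graph leaves `Σ̃_τ = {t* = τ + F}`
for smooth solutions on the exterior chart.** For subextremal `(M, a)` and an admissible height
function `F` (`Kerr.IsAdmissibleHeight M F`) there are `C₀ > 0`, `C₁ ≥ 0` (depending on `M, a` and
the slope bound of `F`) such that every smooth solution `ψ : Kerr.exterior M a → ℝ` of `□_g ψ = 0`
satisfies `E_F(τ) ≤ C₀ e^{C₁ τ} E_F(0)` for all `τ ≥ 0`,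
`E_F(τ) = graphSliceEnergy (Kerr.exterior M a) ψ F τ` (`KerrWaveEnergy.lean`). This is the
inequality of `DafermosRodnianskiShlapentokhRothman2016_energyBoundedness` (`KerrWaveEnergy.lean`)
with an exponentially growing instead of a uniform constant, and without any support hypothesis on
the data. Coordinate form: `Kerr.exterior_graphCoordEnergy_le_exp`. Hawking–Ellis 1973, §4.3,
Lemma 4.3.1; Dafermos–Rodnianski arXiv:1010.5132, Prop. 4.6.1; arXiv:1402.7034, §3.3, §13.1.1.
[cite: HawkingEllis1973CUP, §4.3 Lemma 4.3.1; DafermosRodnianskiShlapentokhrothman2014, §3.3] -/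
theorem kerr_exterior_graphSliceEnergy_le_exp [Kerr.Facts] [Kerr.SliceFacts] {M a : ℝ}
    (hMa : Kerr.IsSubextremal M a) {F : E3 → ℝ} (hF : Kerr.IsAdmissibleHeight M F) :
    ∃ C₀ C₁ : ℝ, 0 < C₀ ∧ 0 ≤ C₁ ∧ ∀ ψ : Kerr.exterior M a → ℝ,
      ContMDiff 𝓘(ℝ, E4) 𝓘(ℝ, ℝ) ∞ ψ →
      (∀ x, (Kerr.smoothMetric M a (Kerr.rPlus M a)).toPseudoRiemannianMetric.dalembertian ψ x
        = 0) →
      ∀ τ : ℝ, 0 ≤ τ →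
        graphSliceEnergy (Kerr.exterior M a) ψ F τ ≤
          ENNReal.ofReal (C₀ * Real.exp (C₁ * τ)) * graphSliceEnergy (Kerr.exterior M a) ψ F 0 := by
  obtain ⟨C₀, C₁, hC₀, hC₁, h⟩ := Kerr.exterior_graphCoordEnergy_le_exp hMa
  obtain ⟨c, hc, hc1, hslope⟩ := hF.exists_slope_le'
  have hF2 : ContDiff ℝ 2 F := hF.contDiff.of_le (WithTop.coe_le_coe.mpr le_top)
  refine ⟨C₀ / c, C₁ / c, by positivity, by positivity, fun ψ hψ hwave τ hτ ↦ ?_⟩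
  set Φ : E4 → ℝ := Function.extend Subtype.val ψ 0 with hΦ
  have hrep : ∀ y, ψ y = Φ y := extend_rep ψ
  have hΦ2 : ∀ z ∈ (Kerr.exterior M a : Set E4), ContDiffAt ℝ 2 Φ z := fun z hz ↦
    (contDiffAt_extend hψ ⟨z, hz⟩).of_le (WithTop.coe_le_coe.mpr le_top)
  have hsol : ∀ z ∈ (Kerr.exterior M a : Set E4),
      KerrSchild.waveOperator (KerrSchild.inverseMetric (fun y ↦ 2 * Kerr.scalarH M a y)
        (Kerr.nullVector a)) Φ z = 0 := by
    intro z hz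
    rw [← Kerr.dalembertian_eq_waveOperator M a (Kerr.rPlus M a) hrep ⟨z, hz⟩ (hΦ2 z hz)]
    exact hwave ⟨z, hz⟩
  have hE : ∀ t, graphSliceEnergy (Kerr.exterior M a) ψ F t =
      ∫⁻ y, {y : E3 | E4.ofTimeSpace (t + F y) y ∈ Kerr.exterior M a}.indicator
        (fun y ↦ ENNReal.ofReal
          (∑ μ, fderiv ℝ Φ (E4.ofTimeSpace (t + F y) y) (E4.basisVector μ) ^ 2)) y := fun t ↦ rfl
  rw [hE τ, hE 0]
  exact h F c hF2 hc hc1 hslope Φ hΦ2 hsol τ hτ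

/-- **Finite-in-time form of the named fact
`DafermosRodnianskiShlapentokhRothman2016_energyBoundedness_horizonRegular`.** For subextremal
`(M, a)`, an inner radius `r₀ ≤ r₊`, an admissible height function `F` and every `T` there is
`C = C(M, a, F, T) < ∞` such that every smooth `ψ : Kerr.region a r₀ → ℝ` solving `□_g ψ = 0` at
the points with `r > r₊` satisfies, for all `τ ∈ [0, T]`,
`E_F(τ) ≤ C · E_F(0)`, `E_F(τ) = graphSliceEnergy (Kerr.exterior M a) ψ|_{r > r₊} F τ` the
coordinate energy through `Σ̃_τ ∩ {r > r₊} = {t* = τ + F, r > r₊}` — i.e. exactly the inequality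
asserted by the named fact (arXiv:1402.7034, Thm. 3.1 (23) in the §3.3 form), for the same class of
solutions (indeed without the compact-support hypothesis on the data), **but with a constant
allowed to depend on an upper bound `T` for `τ`**; the `T`-independence is the content of the
Annals theorem and is not proved in this library. This is the "finite in time energy estimate"
half of the reduction of the §3.3 statement to Theorem 3.1 (Dafermos–Rodnianski arXiv:1010.5132,
Prop. 4.6.1). Proof: `Kerr.exterior_graphCoordEnergy_le_exp` for the representative of `ψ`.
[cite: HawkingEllis1973CUP, §4.3 Lemma 4.3.1; DafermosRodnianskiShlapentokhrothman2014, §3.3] -/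
theorem kerr_horizonRegular_graphSliceEnergy_finiteTime [Kerr.Facts] [Kerr.SliceFacts]
    {M a r₀ : ℝ} (hMa : Kerr.IsSubextremal M a) (hr : r₀ ≤ Kerr.rPlus M a) {F : E3 → ℝ}
    (hF : Kerr.IsAdmissibleHeight M F) (T : ℝ) :
    ∃ C : ℝ≥0∞, C < ⊤ ∧ ∀ ψ : Kerr.region a r₀ → ℝ,
      ContMDiff 𝓘(ℝ, E4) 𝓘(ℝ, ℝ) ∞ ψ →
      (∀ x : Kerr.region a r₀, Kerr.rPlus M a < Kerr.radius a (x : E4) →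
        (Kerr.smoothMetric M a r₀).toPseudoRiemannianMetric.dalembertian ψ x = 0) →
      ∀ τ : ℝ, 0 ≤ τ → τ ≤ T →
        graphSliceEnergy (Kerr.exterior M a)
            (fun y : Kerr.exterior M a ↦ ψ ⟨(y : E4), Kerr.region_mono a hr y.2⟩) F τ ≤
          C * graphSliceEnergy (Kerr.exterior M a)
            (fun y : Kerr.exterior M a ↦ ψ ⟨(y : E4), Kerr.region_mono a hr y.2⟩) F 0 := by
  obtain ⟨C₀, C₁, hC₀, hC₁, h⟩ := Kerr.exterior_graphCoordEnergy_le_exp hMa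
  obtain ⟨c, hc, hc1, hslope⟩ := hF.exists_slope_le'
  have hF2 : ContDiff ℝ 2 F := hF.contDiff.of_le (WithTop.coe_le_coe.mpr le_top)
  refine ⟨ENNReal.ofReal (C₀ / c * Real.exp (C₁ / c * T)), ENNReal.ofReal_lt_top,
    fun ψ hψ hwave τ hτ hτT ↦ ?_⟩
  set ψ' : Kerr.exterior M a → ℝ := fun y ↦ ψ ⟨(y : E4), Kerr.region_mono a hr y.2⟩ with hψ'
  set Φ : E4 → ℝ := Function.extend Subtype.val ψ 0 with hΦ
  set Φ' : E4 → ℝ := Function.extend Subtype.val ψ' 0 with hΦ'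
  have hrep : ∀ y, ψ y = Φ y := extend_rep ψ
  have hrep' : ∀ y, ψ' y = Φ' y := extend_rep ψ'
  have hagree : ∀ z ∈ (Kerr.exterior M a : Set E4), Φ' =ᶠ[𝓝 z] Φ := by
    intro z hz
    filter_upwards [(Kerr.exterior M a).isOpen.mem_nhds hz] with w hw
    rw [← hrep' ⟨w, hw⟩, ← hrep ⟨w, Kerr.region_mono a hr hw⟩]
  have hΦ2 : ∀ z ∈ (Kerr.exterior M a : Set E4), ContDiffAt ℝ 2 Φ z := fun z hz ↦
    (contDiffAt_extend hψ ⟨z, Kerr.region_mono a hr hz⟩).of_le (WithTop.coe_le_coe.mpr le_top)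
  have hsol : ∀ z ∈ (Kerr.exterior M a : Set E4),
      KerrSchild.waveOperator (KerrSchild.inverseMetric (fun y ↦ 2 * Kerr.scalarH M a y)
        (Kerr.nullVector a)) Φ z = 0 := by
    intro z hz
    rw [← Kerr.dalembertian_eq_waveOperator M a r₀ hrep ⟨z, Kerr.region_mono a hr hz⟩ (hΦ2 z hz)]
    exact hwave _ (Kerr.lt_radius_of_mem_region hz)
  have hE : ∀ t, graphSliceEnergy (Kerr.exterior M a) ψ' F t =
      ∫⁻ y, {y : E3 | E4.ofTimeSpace (t + F y) y ∈ Kerr.exterior M a}.indicator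
        (fun y ↦ ENNReal.ofReal
          (∑ μ, fderiv ℝ Φ (E4.ofTimeSpace (t + F y) y) (E4.basisVector μ) ^ 2)) y := by
    intro t
    unfold graphSliceEnergy
    refine lintegral_congr fun y ↦ ?_
    by_cases hy : y ∈ {y : E3 | E4.ofTimeSpace (t + F y) y ∈ Kerr.exterior M a}
    · rw [indicator_of_mem hy, indicator_of_mem hy, ← Kerr.sum_sq_fderiv_extend_eq,
        (hagree _ hy).fderiv_eq]
    · rw [indicator_of_notMem hy, indicator_of_notMem hy]
  rw [hE τ, hE 0]
  refine (h F c hF2 hc hc1 hslope Φ hΦ2 hsol τ hτ).trans ?_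
  exact mul_le_mul_left (ENNReal.ofReal_le_ofReal (mul_le_mul_of_nonneg_left
    (Real.exp_le_exp.mpr (mul_le_mul_of_nonneg_left hτT (by positivity))) (by positivity))) _

end Literature.Geometry.Lorentzian

end
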